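import Literature.NumberTheory.LFunctions.UnconditionalPairCorrelationZeroSide
import Literature.NumberTheory.LFunctions.MontgomeryDirichletSumMeanSquareSharp
import Literature.NumberTheory.LFunctions.ZeroDensityNearOne
import Literature.NumberTheory.LFunctions.VinogradovKorobovFromRichert
import Literature.NumberTheory.LFunctions.MontgomeryExplicitFormulaProofs
import Literature.NumberTheory.LFunctions.DirichletPolynomialDiscreteMeanValue
import HarnessLib

/-!
RH-FREE — «nothing here bears on the truth of RH».

# Discharge of `baluyotEtAl2025_montgomeryTheorem` — the unconditional Montgomery theorem (MT)
# of Baluyot–Goldston–Suriajaya–Turnage-Butterbaugh (arXiv:2501.14545, §2), dyadic window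

Topic `Literature/NumberTheory/LFunctions` (namespace `Literature.NumberTheory.LFunctions`, objects in
`BGSTB2024`). PROOF LAYER: theorems only — no definitions, no named facts. Fourth and last proof file of the discharge:
`UnconditionalPairCorrelationKernel.lean` (Lemma 3), `…ExplicitFormula.lean` (Lemma 1),
`…ZeroSide.lean` (Lemma 4, dyadic), and this file (the `R`-side on `[T,2T]`, the Vinogradov–Korobov
input, and the assembly). Status note (no endorsement): the 2025 correction (MT) of Theorem 1 of the
refereed Acta Arith. paper (2024); the 2025 note says the dyadic statement "could also be done by
modifying each step in the first proof", which is what is done here.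

The printed proof (BGST 2024, proof of Theorem 1, p. 5; 2025, §3): `L(x,T) = R(x,T)` where
`L = ∫|l|²`, `l(x,t) = 2x^{−it}Σ_ρ x^{ρ−1/2}/(1−(ρ−1/2−it)²)` and `r(x,t)` = the right-hand side of
Lemma 1; `L = 2π𝓕 + O(x^{1−2η}log³T) + O(x)` (Lemma 4) with `η` from the Vinogradov–Korobov
zero-free region, "`x^{1−2η(T log²T)}log³T ≪ T^{1/2}log³T`" for `x ≤ T^{1/2}` and "`≪ x`" for
`T^{1/2} ≤ x ≤ T`; and `R = M₁ + M₂ + O(|∫A₁Ā₂|) + O(T√log T) + O(T x⁻² log T)` with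
`M₁ = T x⁻²(log²T + O(log T))`, `M₂ = T log x + O(T√log T)` ([GM87]), the cross term by
"`∫_0^T n^{it} log(t+2) dt ≪ log T/log n`" (Garunkštis–Paliulionytė). Here, multiplied through by
`x` (the tree's `A(x,t) = Σ Λ(n)a_n(x)n^{−it}` carries the factor `x^{1/2}`) and on the window `[T,2T]`:

* §1 `BGSTB2024.exists_vkTheta` — the Vinogradov–Korobov input: an exponent `θ(T) ≤ 1` with `Re ρ ≤ θ(T)` for all zeros with `|γ| ≤ T²`
  and `T^{θ(T)−1} log³(2T+2) ≤ √log T` for all large `T` (tree: `exists_richertTypeBound_one`,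
  `VKFromRichert.zeta_zeroFree_of_richertType`, standard axioms).
* §2 the cross term `|∫_0^T log(t+2)A(x,t)dt| ≤ Kx log(T+2)` (integration by parts; the argument of
  `MontgomeryTheoremGoldstonMontgomery.lean` §§2–3, whose lemmas are private there).
* §3 `BGSTB2024.rside_window` — `|∫_T^{2T}|2x^{1/2−it}S_u|² − (Tx log x + (T/x)log²T)| ≤
  C(T log^{3/2}T/x + xT√log T)` for `1 ≤ x ≤ T`, `T ≥ 4` (Lemma 1 = `baluyotEtAl2024_lemma1`,
  (P3♯) = `Montgomery.exists_meanSquare_dirichletSum_sharp` at `2T` and `T`, §2, and the `L²` algebra).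
* §4 `baluyotEtAl2025_montgomeryTheorem_holds`.

## References

* [BaluyotEtAl2025] arXiv:2501.14545, §2 (MT) (Mon-1) and §3 (proof); held text
  `paper:arxiv-2501.14545` p0005–p0007.
* [BaluyotEtAl2024] Acta Arith. 214 (2024) = arXiv:2306.04799, §2, Lemmas 1–4 and the proof of
  Theorem 1 (p0004–p0005 of the held text).
* [GoldstonMontgomery1987] §3, Lemmas 6–8 ((P3♯)); [Goldston2005] §4; [Montgomery1973] §3.
* [Titchmarsh1986] Theorem 3.10 and §6.19 (the Vinogradov–Korobov zero-free region, as in the tree).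
-/

noncomputable section

open Complex Filter Set MeasureTheory intervalIntegral Asymptotics
open scoped Real Topology ComplexConjugate

namespace Literature.NumberTheory.LFunctions

namespace BGSTB2024

open Montgomery

/-! ## §1. The Vinogradov–Korobov input: the exponent `θ(T)` -/

/-- The real parts of the (finitely many) non-trivial zeros with `|γ| ≤ 21` are bounded by some
`θ₀ < 1` (each has `Re ρ < 1`). [folklore] -/
private theorem exists_re_le_of_abs_im_le :
    ∃ θ₀ : ℝ, θ₀ < 1 ∧ 1 / 2 ≤ θ₀ ∧ ∀ ρ ∈ ZetaZeros.riemannZetaNontrivialZeros, |ρ.im| ≤ 21 → ρ.re ≤ θ₀ := by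
  set F : Finset ZetaZeros.riemannZetaNontrivialZeros := weilZeroFinset 21 with hF
  set g : ZetaZeros.riemannZetaNontrivialZeros → ℝ := fun ρ ↦ (ρ : ℂ).re with hg
  by_cases hne : (F.image g).Nonempty
  · set m : ℝ := (F.image g).max' hne with hm
    have hm1 : m < 1 := by
      obtain ⟨ρ, _, hρ⟩ := Finset.mem_image.1 ((F.image g).max'_mem hne)
      rw [hm, ← hρ, hg]
      exact ZetaZeros.riemannZetaNontrivialZeros.re_lt_one ρ.2
    refine ⟨max m (1 / 2), max_lt hm1 (by norm_num), le_max_right _ _, fun ρ hρ h21 ↦ ?_⟩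
    refine le_trans ?_ (le_max_left _ _)
    have hmem : (⟨ρ, hρ⟩ : ZetaZeros.riemannZetaNontrivialZeros) ∈ F := by
      rw [hF, mem_weilZeroFinset]; exact h21
    have := Finset.le_max' (F.image g) _ (Finset.mem_image.2 ⟨⟨ρ, hρ⟩, hmem, rfl⟩)
    simpa [hg, hm] using this
  · refine ⟨1 / 2, by norm_num, le_rfl, fun ρ hρ h21 ↦ ?_⟩
    exfalso
    have hmem : (⟨ρ, hρ⟩ : ZetaZeros.riemannZetaNontrivialZeros) ∈ F := by
      rw [hF, mem_weilZeroFinset]; exact h21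
    exact hne ⟨g ⟨ρ, hρ⟩, Finset.mem_image.2 ⟨⟨ρ, hρ⟩, hmem, rfl⟩⟩

/-- The Vinogradov–Korobov denominator `f(u) = (log u)^{2/3}(log log u)^{1/3}` is positive for
`u ≥ 21`. [folklore] -/
private theorem vkDenom_pos {u : ℝ} (hu : 21 ≤ u) :
    0 < Real.log u ^ (2 / 3 : ℝ) * Real.log (Real.log u) ^ (1 / 3 : ℝ) := by
  have h1 : 1 < Real.log u := by
    rw [← Real.log_exp 1]
    exact Real.log_lt_log (Real.exp_pos 1) (by linarith [Real.exp_one_lt_d9])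
  have h2 : 0 < Real.log (Real.log u) := Real.log_pos h1
  exact mul_pos (Real.rpow_pos_of_pos (by linarith) _) (Real.rpow_pos_of_pos h2 _)

/-- `f` is monotone on `[21, ∞)`. [folklore] -/
private theorem vkDenom_mono {u v : ℝ} (hu : 21 ≤ u) (huv : u ≤ v) :
    Real.log u ^ (2 / 3 : ℝ) * Real.log (Real.log u) ^ (1 / 3 : ℝ) ≤
      Real.log v ^ (2 / 3 : ℝ) * Real.log (Real.log v) ^ (1 / 3 : ℝ) := by
  have h1 : 1 < Real.log u := by
    rw [← Real.log_exp 1]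
    exact Real.log_lt_log (Real.exp_pos 1) (by linarith [Real.exp_one_lt_d9])
  have hlog : Real.log u ≤ Real.log v := Real.log_le_log (by linarith) huv
  have hll : Real.log (Real.log u) ≤ Real.log (Real.log v) := Real.log_le_log (by linarith) hlog
  have h2 : 0 ≤ Real.log (Real.log u) := (Real.log_pos h1).le
  exact mul_le_mul (Real.rpow_le_rpow (by linarith) hlog (by norm_num))
    (Real.rpow_le_rpow h2 hll (by norm_num)) (Real.rpow_nonneg h2 _)
    (Real.rpow_nonneg (by linarith [hlog]) _)

/-- **The exponent `θ(T)`**: there are `θ₀ < 1` and `c > 0` (the tree's Vinogradov–Korobov constant)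
such that, with `θ(T) = max(θ₀, 1 − c/((log T²)^{2/3}(log log T²)^{1/3}))`, every non-trivial zero
with `|γ| ≤ T²` has `Re ρ ≤ θ(T)` (`T ≥ 5`), `θ(T) ≤ 1`, and `T^{θ(T)−1} log³(2T+2) ≤ √log T` for all
large `T` (the step "`x^{1−2η(T log²T)} log³T ≪ …`" of the source, with `Z = T²`).
[cite: BaluyotEtAl2024, §2 (proof of Theorem 1, the Korobov–Vinogradov step)] -/
theorem exists_vkTheta : ∃ θ : ℝ → ℝ,
    (∀ T : ℝ, 5 ≤ T → θ T ≤ 1 ∧ 1 / 2 ≤ θ T ∧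
      ∀ ρ ∈ ZetaZeros.riemannZetaNontrivialZeros, |ρ.im| ≤ T ^ 2 → ρ.re ≤ θ T) ∧
    ∀ᶠ T : ℝ in atTop, T ^ (θ T - 1) * Real.log (2 * T + 2) ^ 3 ≤ Real.sqrt (Real.log T) := by
  obtain ⟨θ₀, hθ₀1, hθ₀h, hθ₀⟩ := exists_re_le_of_abs_im_le
  obtain ⟨A, B, -, -, hR⟩ := exists_richertTypeBound_one
  obtain ⟨c, hc, hzf⟩ := VKFromRichert.zeta_zeroFree_of_richertType hR (by norm_num)
  set θ₁ : ℝ → ℝ := fun T ↦ 1 - c / (Real.log (T ^ 2) ^ (2 / 3 : ℝ) *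
    Real.log (Real.log (T ^ 2)) ^ (1 / 3 : ℝ)) with hθ₁
  refine ⟨fun T ↦ max θ₀ (θ₁ T), fun T hT ↦ ⟨?_, ?_, ?_⟩, ?_⟩
  · -- `θ(T) ≤ 1`
    have h21 : (21 : ℝ) ≤ T ^ 2 := by nlinarith
    refine max_le hθ₀1.le ?_
    simp only [hθ₁]
    have := div_nonneg hc.le (vkDenom_pos h21).le
    linarith
  · exact le_trans hθ₀h (le_max_left _ _)
  · -- every zero with `|γ| ≤ T²` has `Re ρ ≤ θ(T)`
    intro ρ hρ hγ
    have h21 : (21 : ℝ) ≤ T ^ 2 := by nlinarith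
    rcases le_or_gt |ρ.im| 21 with hsmall | hbig
    · exact (hθ₀ ρ hρ hsmall).trans (le_max_left _ _)
    · refine le_trans ?_ (le_max_right _ _)
      simp only [hθ₁]
      -- contrapositive of the zero-free region at `ρ`
      have hlt : ρ.re < 1 - c / (Real.log |ρ.im| ^ (2 / 3 : ℝ) * Real.log (Real.log |ρ.im|) ^ (1 / 3 : ℝ)) := by
        by_contra h
        push Not at h
        exact hzf ρ hbig.le h (ZetaZeros.riemannZetaNontrivialZeros.zeta_eq_zero hρ)
      have hmono := vkDenom_mono hbig.le hγ
      have hdiv : c / (Real.log (T ^ 2) ^ (2 / 3 : ℝ) * Real.log (Real.log (T ^ 2)) ^ (1 / 3 : ℝ)) ≤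
          c / (Real.log |ρ.im| ^ (2 / 3 : ℝ) * Real.log (Real.log |ρ.im|) ^ (1 / 3 : ℝ)) :=
        div_le_div_of_nonneg_left hc.le (vkDenom_pos hbig.le) hmono
      linarith
  · -- the eventual bound `T^{θ(T)−1} log³(2T+2) ≤ √log T`
    -- (i) the `θ₀`-branch: `log T ≤ ½ T^{(1−θ₀)/3}` eventually
    have hr : 0 < (1 - θ₀) / 3 := by linarith
    have hi : ∀ᶠ T : ℝ in atTop, Real.log T ≤ 1 / 2 * T ^ ((1 - θ₀) / 3) := by
      filter_upwards [(isLittleO_log_rpow_atTop hr).def (by norm_num : (0 : ℝ) < 1 / 2),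
        eventually_ge_atTop 1] with T h hT1
      rw [Real.norm_of_nonneg (Real.log_nonneg hT1),
        Real.norm_of_nonneg (Real.rpow_nonneg (by linarith) _)] at h
      exact h
    -- (ii) the VK branch: with `u = log T`, `16 log² u ≤ c u^{1/3}` eventually
    have hii : ∀ᶠ T : ℝ in atTop, 16 * Real.log (Real.log T) ^ 2 ≤ c * Real.log T ^ (1 / 3 : ℝ) ∧
        16 ≤ Real.log T := by
      have hu : ∀ᶠ u : ℝ in atTop, 16 * Real.log u ^ 2 ≤ c * u ^ (1 / 3 : ℝ) ∧ 16 ≤ u := by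
        have hκ : 0 < Real.sqrt (c / 16) := Real.sqrt_pos.2 (by positivity)
        filter_upwards [(isLittleO_log_rpow_atTop (by norm_num : (0 : ℝ) < 1 / 6)).def hκ,
          eventually_ge_atTop 16] with u h hu16
        refine ⟨?_, hu16⟩
        rw [Real.norm_of_nonneg (Real.log_nonneg (by linarith)),
          Real.norm_of_nonneg (Real.rpow_nonneg (by linarith) _)] at h
        have h0 : 0 ≤ Real.log u := Real.log_nonneg (by linarith)
        have h2 := pow_le_pow_left₀ h0 h 2
        have e : (Real.sqrt (c / 16) * u ^ (1 / 6 : ℝ)) ^ 2 = c / 16 * u ^ (1 / 3 : ℝ) := by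
          rw [mul_pow, Real.sq_sqrt (by positivity), ← Real.rpow_natCast, ← Real.rpow_mul (by linarith)]
          norm_num
        rw [e] at h2
        linarith
      exact Real.tendsto_log_atTop.eventually hu
    filter_upwards [hi, hii, eventually_ge_atTop 5] with T h1 h2 hT5
    obtain ⟨h2, hL16⟩ := h2
    have hT1 : 1 < T := by linarith
    have hT0 : 0 < T := by linarith
    set u : ℝ := Real.log T with hu
    have hu0 : 0 < u := by linarith
    have hL : Real.log (2 * T + 2) ≤ 2 * u := by
      have : 2 * T + 2 ≤ T ^ 2 := by nlinarith
      calc Real.log (2 * T + 2) ≤ Real.log (T ^ 2) := Real.log_le_log (by linarith) this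
        _ = 2 * u := by rw [Real.log_pow, hu]; norm_num
    have hL0 : 0 ≤ Real.log (2 * T + 2) := Real.log_nonneg (by linarith)
    have hL3 : Real.log (2 * T + 2) ^ 3 ≤ 8 * u ^ 3 := by
      have := pow_le_pow_left₀ hL0 hL 3; nlinarith
    have hsqrt : 4 ≤ Real.sqrt u := by
      rw [show (4 : ℝ) = Real.sqrt 16 by rw [show (16 : ℝ) = 4 ^ 2 by norm_num, Real.sqrt_sq (by norm_num)]]
      exact Real.sqrt_le_sqrt hL16
    -- `T^{max(a,b) − 1} ≤ T^{a−1} + T^{b−1}`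
    have hmax : T ^ (max θ₀ (θ₁ T) - 1) ≤ T ^ (θ₀ - 1) + T ^ (θ₁ T - 1) := by
      rcases le_total θ₀ (θ₁ T) with h | h
      · rw [max_eq_right h]; linarith [Real.rpow_nonneg hT0.le (θ₀ - 1)]
      · rw [max_eq_left h]; linarith [Real.rpow_nonneg hT0.le (θ₁ T - 1)]
    -- branch (i): `T^{θ₀−1} · 8u³ ≤ 1`
    have hbi : T ^ (θ₀ - 1) * Real.log (2 * T + 2) ^ 3 ≤ 1 := by
      have h3 : u ^ 3 ≤ 1 / 8 * T ^ (1 - θ₀) := by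
        have := pow_le_pow_left₀ hu0.le h1 3
        have e : (1 / 2 * T ^ ((1 - θ₀) / 3)) ^ 3 = 1 / 8 * T ^ (1 - θ₀) := by
          rw [mul_pow, ← Real.rpow_natCast (T ^ ((1 - θ₀) / 3)), ← Real.rpow_mul hT0.le]
          norm_num
        rwa [e] at this
      have hneg : T ^ (θ₀ - 1) = (T ^ (1 - θ₀))⁻¹ := by
        rw [← Real.rpow_neg hT0.le]; congr 1; ring
      have hpos : 0 < T ^ (1 - θ₀) := Real.rpow_pos_of_pos hT0 _
      rw [hneg]
      calc (T ^ (1 - θ₀))⁻¹ * Real.log (2 * T + 2) ^ 3 ≤ (T ^ (1 - θ₀))⁻¹ * (8 * u ^ 3) :=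
            mul_le_mul_of_nonneg_left hL3 (inv_nonneg.2 hpos.le)
        _ ≤ (T ^ (1 - θ₀))⁻¹ * T ^ (1 - θ₀) := mul_le_mul_of_nonneg_left (by linarith) (inv_nonneg.2 hpos.le)
        _ = 1 := inv_mul_cancel₀ hpos.ne'
    -- branch (ii): `T^{θ₁(T)−1} ≤ u^{−4}`, so `T^{θ₁−1} · 8u³ ≤ 8/u ≤ 1/2`
    have hbii : T ^ (θ₁ T - 1) * Real.log (2 * T + 2) ^ 3 ≤ 1 / 2 := by
      have hu2 : 2 ≤ u := by linarith
      -- `f(T²) ≤ 4 u^{2/3} log u`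
      have hlogT2 : Real.log (T ^ 2) = 2 * u := by rw [Real.log_pow, hu]; norm_num
      have hlu : 0 < Real.log u := Real.log_pos (by linarith)
      have hf : Real.log (T ^ 2) ^ (2 / 3 : ℝ) * Real.log (Real.log (T ^ 2)) ^ (1 / 3 : ℝ) ≤
          4 * u ^ (2 / 3 : ℝ) * Real.log u := by
        rw [hlogT2]
        have ha : (2 * u) ^ (2 / 3 : ℝ) ≤ 2 * u ^ (2 / 3 : ℝ) := by
          rw [Real.mul_rpow (by norm_num) hu0.le]
          refine mul_le_mul_of_nonneg_right ?_ (Real.rpow_nonneg hu0.le _)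
          calc (2 : ℝ) ^ (2 / 3 : ℝ) ≤ (2 : ℝ) ^ (1 : ℝ) :=
                Real.rpow_le_rpow_of_exponent_le (by norm_num) (by norm_num)
            _ = 2 := Real.rpow_one 2
        have hb : Real.log (2 * u) ^ (1 / 3 : ℝ) ≤ 2 * Real.log u := by
          have hl2u : 1 ≤ Real.log (2 * u) := by
            rw [← Real.log_exp 1]
            exact Real.log_le_log (Real.exp_pos 1) (by linarith [Real.exp_one_lt_d9])
          calc Real.log (2 * u) ^ (1 / 3 : ℝ) ≤ Real.log (2 * u) ^ (1 : ℝ) :=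
                Real.rpow_le_rpow_of_exponent_le hl2u (by norm_num)
            _ = Real.log (2 * u) := Real.rpow_one _
            _ = Real.log 2 + Real.log u := Real.log_mul (by norm_num) hu0.ne'
            _ ≤ 2 * Real.log u := by
                have : Real.log 2 ≤ Real.log u := Real.log_le_log (by norm_num) hu2
                linarith
        have hb0 : 0 ≤ Real.log (2 * u) ^ (1 / 3 : ℝ) := Real.rpow_nonneg (Real.log_nonneg (by linarith)) _
        calc (2 * u) ^ (2 / 3 : ℝ) * Real.log (2 * u) ^ (1 / 3 : ℝ)
            ≤ (2 * u ^ (2 / 3 : ℝ)) * (2 * Real.log u) :=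
              mul_le_mul ha hb hb0 (by positivity)
          _ = 4 * u ^ (2 / 3 : ℝ) * Real.log u := by ring
      have h21 : (21 : ℝ) ≤ T ^ 2 := by nlinarith
      have hfpos := vkDenom_pos h21
      set fT : ℝ := Real.log (T ^ 2) ^ (2 / 3 : ℝ) * Real.log (Real.log (T ^ 2)) ^ (1 / 3 : ℝ) with hfT
      -- `c u / f(T²) ≥ 4 log u`
      have hkey : 4 * Real.log u ≤ c / fT * u := by
        rw [div_mul_eq_mul_div, le_div_iff₀ hfpos]
        have hu13 : u = u ^ (1 / 3 : ℝ) * u ^ (2 / 3 : ℝ) := by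
          rw [← Real.rpow_add hu0]; norm_num
        calc 4 * Real.log u * fT ≤ 4 * Real.log u * (4 * u ^ (2 / 3 : ℝ) * Real.log u) :=
              mul_le_mul_of_nonneg_left hf (by positivity)
          _ = (16 * Real.log u ^ 2) * u ^ (2 / 3 : ℝ) := by ring
          _ ≤ (c * u ^ (1 / 3 : ℝ)) * u ^ (2 / 3 : ℝ) :=
              mul_le_mul_of_nonneg_right h2 (Real.rpow_nonneg hu0.le _)
          _ = c * u := by rw [mul_assoc, ← hu13]
      -- hence `T^{θ₁−1} ≤ exp(−4 log u) = u^{−4}`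
      have hexp : T ^ (θ₁ T - 1) ≤ (u ^ 4)⁻¹ := by
        have e1 : T ^ (θ₁ T - 1) = Real.exp (-(c / fT * u)) := by
          rw [Real.rpow_def_of_pos hT0, ← hu]
          congr 1
          simp only [hθ₁]
          ring
        have e2 : (u ^ 4)⁻¹ = Real.exp (-(4 * Real.log u)) := by
          rw [Real.exp_neg, show (4 : ℝ) * Real.log u = Real.log (u ^ 4) by
            rw [Real.log_pow]; norm_num, Real.exp_log (by positivity)]
        rw [e1, e2]
        exact Real.exp_le_exp.2 (by linarith)
      have hu4 : 0 < u ^ 4 := by positivity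
      calc T ^ (θ₁ T - 1) * Real.log (2 * T + 2) ^ 3 ≤ (u ^ 4)⁻¹ * (8 * u ^ 3) :=
            mul_le_mul hexp hL3 (pow_nonneg hL0 3) (inv_nonneg.2 hu4.le)
        _ = 8 / u := by field_simp
        _ ≤ 1 / 2 := by rw [div_le_iff₀ hu0]; linarith
    calc T ^ (max θ₀ (θ₁ T) - 1) * Real.log (2 * T + 2) ^ 3
        ≤ (T ^ (θ₀ - 1) + T ^ (θ₁ T - 1)) * Real.log (2 * T + 2) ^ 3 :=
          mul_le_mul_of_nonneg_right hmax (pow_nonneg hL0 3)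
      _ = T ^ (θ₀ - 1) * Real.log (2 * T + 2) ^ 3 + T ^ (θ₁ T - 1) * Real.log (2 * T + 2) ^ 3 := by ring
      _ ≤ 1 + 1 / 2 := add_le_add hbi hbii
      _ ≤ Real.sqrt u := by linarith

/-! ## §2. The cross term `∫_0^T log(t+2) A(x,t) dt` (integration by parts)

The two lemmas of `MontgomeryTheoremGoldstonMontgomery.lean` §§2–3 (private there), verbatim. -/

/-- **Integration by parts**: for `n ≥ 2` and `T ≥ 0`, `|∫_0^T log(t+2) n^{-it} dt| ≤ 2 log(T+2)/log n`.
[folklore] -/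
private theorem norm_integral_log_mul_cpow_le {n : ℕ} (hn : 2 ≤ n) {T : ℝ} (hT : 0 ≤ T) :
    ‖∫ t in (0 : ℝ)..T, (Real.log (t + 2) : ℂ) * (n : ℂ) ^ (-((t : ℂ) * I))‖ ≤
      2 * Real.log (T + 2) / Real.log n := by
  have hn0 : n ≠ 0 := by omega
  set ω : ℝ := Real.log n with hω
  have hω0 : 0 < ω := Real.log_pos (by exact_mod_cast (by omega : 1 < n))
  set d : ℂ := -((ω : ℂ) * I) with hd
  have hdnorm : ‖d‖ = ω := by
    rw [hd, norm_neg, norm_mul, Complex.norm_real, Complex.norm_I, mul_one, Real.norm_of_nonneg hω0.le]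
  have hd0 : d ≠ 0 := by
    intro h; rw [← norm_eq_zero, hdnorm] at h; exact hω0.ne' h
  set e : ℝ → ℂ := fun t ↦ (n : ℂ) ^ (-((t : ℂ) * I)) with he
  have henorm : ∀ t : ℝ, ‖e t‖ = 1 := fun t ↦ by
    simp only [he]; rw [natCast_cpow_neg_mul_I hn0, Complex.norm_exp_ofReal_mul_I]
  have hev : ∀ t : ℝ, HasDerivAt (fun y : ℝ ↦ e y / d) (e t) t := by
    intro t
    have h := (hasDerivAt_natCast_cpow_neg_mul_I hn0 t).div_const d
    have hnum : (n : ℂ) ^ (-((t : ℂ) * I)) * (-(Real.log n : ℂ) * I) / d = e t := by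
      rw [show (-(Real.log n : ℂ) * I) = d by rw [hd, hω, neg_mul], mul_div_assoc, div_self hd0, mul_one]
    exact h.congr_deriv hnum
  have heu : ∀ t ∈ Set.uIcc 0 T, HasDerivAt (fun y : ℝ ↦ (Real.log (y + 2) : ℂ)) (((1 / (t + 2) : ℝ)) : ℂ) t := by
    intro t ht
    rw [Set.uIcc_of_le hT] at ht
    have ht2 : t + 2 ≠ 0 := by linarith [ht.1]
    have h1 : HasDerivAt (fun y : ℝ ↦ Real.log (y + 2)) (1 / (t + 2)) t := by
      have := ((hasDerivAt_id t).add_const 2).log ht2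
      simpa using this
    exact h1.ofReal_comp
  have hcu' : ContinuousOn (fun t : ℝ ↦ (((1 / (t + 2) : ℝ)) : ℂ)) (Set.uIcc 0 T) := by
    refine Complex.continuous_ofReal.comp_continuousOn (ContinuousOn.div continuousOn_const (by fun_prop) ?_)
    intro t ht; rw [Set.uIcc_of_le hT] at ht; linarith [ht.1]
  have hce : Continuous e := continuous_natCast_cpow_neg_mul_I hn0
  have hparts := intervalIntegral.integral_mul_deriv_eq_deriv_mul heu (fun t _ ↦ hev t)
    (hcu'.intervalIntegrable) (hce.intervalIntegrable 0 T)
  have hlogT : 0 ≤ Real.log (T + 2) := Real.log_nonneg (by linarith)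
  have hlog2 : 0 ≤ Real.log 2 := Real.log_nonneg (by norm_num)
  have hb1 : ‖(Real.log (T + 2) : ℂ) * (e T / d)‖ = Real.log (T + 2) / ω := by
    rw [norm_mul, norm_div, henorm, hdnorm, Complex.norm_real, Real.norm_of_nonneg hlogT]; ring
  have hb2 : ‖(Real.log ((0 : ℝ) + 2) : ℂ) * (e 0 / d)‖ = Real.log 2 / ω := by
    rw [zero_add, norm_mul, norm_div, henorm, hdnorm, Complex.norm_real, Real.norm_of_nonneg hlog2]; ring
  have hb3 : ‖∫ t in (0 : ℝ)..T, (((1 / (t + 2) : ℝ)) : ℂ) * (e t / d)‖ ≤ (Real.log (T + 2) - Real.log 2) / ω := by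
    have hle : ‖∫ t in (0 : ℝ)..T, (((1 / (t + 2) : ℝ)) : ℂ) * (e t / d)‖ ≤ ∫ t in (0 : ℝ)..T, (t + 2)⁻¹ / ω := by
      refine intervalIntegral.norm_integral_le_of_norm_le hT ?_ ?_
      · refine Eventually.of_forall fun t ht ↦ ?_
        have ht2 : 0 < t + 2 := by linarith [ht.1.le]
        rw [norm_mul, norm_div, henorm, hdnorm, Complex.norm_real, Real.norm_of_nonneg (by positivity)]
        exact le_of_eq (by rw [one_div]; ring)
      · refine ContinuousOn.intervalIntegrable ?_
        refine ContinuousOn.div_const (ContinuousOn.inv₀ (by fun_prop) fun t ht ↦ ?_) _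
        rw [Set.uIcc_of_le hT] at ht; linarith [ht.1]
    refine hle.trans (le_of_eq ?_)
    rw [intervalIntegral.integral_div, intervalIntegral.integral_comp_add_right (fun t : ℝ ↦ t⁻¹) 2,
      integral_inv_of_pos (by norm_num) (by linarith), zero_add, Real.log_div (by linarith) (by norm_num)]
  rw [hparts]
  calc ‖(Real.log (T + 2) : ℂ) * (e T / d) - (Real.log ((0 : ℝ) + 2) : ℂ) * (e 0 / d) -
        ∫ t in (0 : ℝ)..T, (((1 / (t + 2) : ℝ)) : ℂ) * (e t / d)‖
      ≤ ‖(Real.log (T + 2) : ℂ) * (e T / d) - (Real.log ((0 : ℝ) + 2) : ℂ) * (e 0 / d)‖ +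
        ‖∫ t in (0 : ℝ)..T, (((1 / (t + 2) : ℝ)) : ℂ) * (e t / d)‖ := norm_sub_le _ _
    _ ≤ ‖(Real.log (T + 2) : ℂ) * (e T / d)‖ + ‖(Real.log ((0 : ℝ) + 2) : ℂ) * (e 0 / d)‖ +
        ‖∫ t in (0 : ℝ)..T, (((1 / (t + 2) : ℝ)) : ℂ) * (e t / d)‖ := by
        gcongr; exact norm_sub_le _ _
    _ ≤ Real.log (T + 2) / ω + Real.log 2 / ω + (Real.log (T + 2) - Real.log 2) / ω := by
        rw [hb1, hb2]; gcongr
    _ = 2 * Real.log (T + 2) / ω := by field_simp; ring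

/-- **The cross term**: there is an absolute `K` such that for `x ≥ 1` and `T ≥ 0`,
`|∫_0^T log(t+2) A(x,t) dt| ≤ K x log(T+2)` ("`∫_0^T n^{it}log(t+2)dt ≪ log T/log n`" summed with the
weights `Λ(n)a_n(x)`; BGSTB 2025 §3, the argument of Garunkštis–Paliulionytė, in the crude form of
`MontgomeryTheoremGoldstonMontgomery.lean`). [cite: BaluyotEtAl2025, §3 (proof of Theorem 1 in [BGST-PC])] -/
theorem exists_norm_integral_log_mul_dirichletSum_le :
    ∃ K : ℝ, 0 ≤ K ∧ ∀ x : ℝ, 1 ≤ x → ∀ T : ℝ, 0 ≤ T →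
      ‖∫ t in (0 : ℝ)..T, (Real.log (t + 2) : ℂ) * montgomeryDirichletSum x t‖ ≤
        K * x * Real.log (T + 2) := by
  have hK0 : 0 ≤ 2 / Real.log 2 * (13 * (Real.log 4 + 4)) := by
    have := Real.log_pos (by norm_num : (1:ℝ) < 2)
    have := Real.log_nonneg (by norm_num : (1:ℝ) ≤ 4)
    positivity
  refine ⟨2 / Real.log 2 * (13 * (Real.log 4 + 4)), hK0, fun x hx T hT ↦ ?_⟩
  have hx0 : 0 < x := by linarith
  have hl2 : 0 < Real.log 2 := Real.log_pos (by norm_num)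
  have hl4 : 0 ≤ Real.log 4 := Real.log_nonneg (by norm_num)
  have hlogT : 0 ≤ Real.log (T + 2) := Real.log_nonneg (by linarith)
  set c : ℕ → ℝ := montgomeryCoeff x with hc
  have hc0 : ∀ n, 0 ≤ c n := fun n ↦ montgomeryCoeff_nonneg hx0.le n
  set F : ℕ → ℝ → ℂ := fun n t ↦ (Real.log (t + 2) : ℂ) * ((c n : ℂ) * (n : ℂ) ^ (-((t : ℂ) * I))) with hF
  have hFnorm : ∀ n, ∀ t ∈ Set.Ioc 0 T, ‖F n t‖ ≤ Real.log (T + 2) * c n := by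
    intro n t ht
    simp only [hF, norm_mul]
    have h1 : ‖(Real.log (t + 2) : ℂ)‖ ≤ Real.log (T + 2) := by
      rw [Complex.norm_real, Real.norm_of_nonneg (Real.log_nonneg (by linarith [ht.1]))]
      exact Real.log_le_log (by linarith [ht.1]) (by linarith [ht.2])
    have h2 : ‖(c n : ℂ)‖ * ‖(n : ℂ) ^ (-((t : ℂ) * I))‖ ≤ c n := by
      have := norm_montgomeryDirichletSummand_le hx0 t n
      rwa [norm_mul] at this
    exact mul_le_mul h1 h2 (by positivity) hlogT
  have hFmeas : ∀ n, Measurable (F n) := by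
    intro n
    rcases Nat.eq_zero_or_pos n with rfl | hn
    · have : F 0 = fun _ ↦ 0 := by funext t; simp [hF, hc]
      rw [this]; exact measurable_const
    · simp only [hF]
      refine Measurable.mul ?_ (measurable_const.mul (continuous_natCast_cpow_neg_mul_I hn.ne').measurable)
      exact Complex.measurable_ofReal.comp (Real.measurable_log.comp (measurable_id.add_const 2))
  have hFint : ∀ n, Integrable (F n) (volume.restrict (Set.Ioc 0 T)) := by
    intro n
    refine Measure.integrableOn_of_bounded (M := Real.log (T + 2) * c n) measure_Ioc_lt_top.ne
      (hFmeas n).aestronglyMeasurable ?_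
    exact (ae_restrict_iff' measurableSet_Ioc).2 (Eventually.of_forall (hFnorm n))
  have hsumc : Summable fun n ↦ c n := by
    have := summable_norm_montgomeryCoeff hx0
    refine this.congr fun n ↦ ?_
    rw [Complex.norm_real, Real.norm_of_nonneg (hc0 n)]
  have hFsum : Summable fun n ↦ ∫ t in Set.Ioc 0 T, ‖F n t‖ := by
    refine Summable.of_nonneg_of_le (fun n ↦ integral_nonneg fun t ↦ norm_nonneg _) (fun n ↦ ?_)
      ((hsumc.mul_left (Real.log (T + 2))).mul_left T)
    calc ∫ t in Set.Ioc 0 T, ‖F n t‖ ≤ ∫ t in Set.Ioc 0 T, Real.log (T + 2) * c n := by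
          refine setIntegral_mono_on (hFint n).norm (integrableOn_const (by simp)) measurableSet_Ioc
            fun t ht ↦ hFnorm n t ht
      _ = T * (Real.log (T + 2) * c n) := by
          rw [setIntegral_const, smul_eq_mul, Real.volume_real_Ioc_of_le hT, sub_zero]
  have hswap : ∫ t in (0 : ℝ)..T, (Real.log (t + 2) : ℂ) * montgomeryDirichletSum x t =
      ∑' n, ∫ t in (0 : ℝ)..T, F n t := by
    rw [intervalIntegral.integral_of_le hT]
    simp_rw [intervalIntegral.integral_of_le hT]
    rw [integral_tsum_of_summable_integral_norm hFint hFsum]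
    refine setIntegral_congr_fun measurableSet_Ioc fun t _ ↦ ?_
    simp only [hF, montgomeryDirichletSum, hc]
    rw [← tsum_mul_left]
  have hterm : ∀ n, ‖∫ t in (0 : ℝ)..T, F n t‖ ≤ 2 / Real.log 2 * Real.log (T + 2) * c n := by
    intro n
    rcases lt_or_ge n 2 with hn | hn
    · interval_cases n
      · simp [hF, hc]
      · simp [hF, hc, montgomeryCoeff]
    · have hln : Real.log 2 ≤ Real.log n := Real.log_le_log (by norm_num) (by exact_mod_cast hn)
      have e : (∫ t in (0 : ℝ)..T, F n t) =
          (c n : ℂ) * ∫ t in (0 : ℝ)..T, (Real.log (t + 2) : ℂ) * (n : ℂ) ^ (-((t : ℂ) * I)) := by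
        rw [← intervalIntegral.integral_const_mul]
        refine intervalIntegral.integral_congr fun t _ ↦ ?_
        simp only [hF]; ring
      rw [e, norm_mul, Complex.norm_real, Real.norm_of_nonneg (hc0 n)]
      have h1 := norm_integral_log_mul_cpow_le hn hT
      calc c n * ‖∫ t in (0 : ℝ)..T, (Real.log (t + 2) : ℂ) * (n : ℂ) ^ (-((t : ℂ) * I))‖
          ≤ c n * (2 * Real.log (T + 2) / Real.log n) := mul_le_mul_of_nonneg_left h1 (hc0 n)
        _ ≤ c n * (2 * Real.log (T + 2) / Real.log 2) := by
            refine mul_le_mul_of_nonneg_left ?_ (hc0 n)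
            exact div_le_div_of_nonneg_left (by positivity) hl2 hln
        _ = 2 / Real.log 2 * Real.log (T + 2) * c n := by ring
  have hsumterm : Summable fun n ↦ 2 / Real.log 2 * Real.log (T + 2) * c n := hsumc.mul_left _
  have htsumc : ∑' n, c n ≤ 13 * (Real.log 4 + 4) * x := by
    refine Real.tsum_le_of_sum_range_le hc0 fun N ↦ ?_
    calc ∑ i ∈ Finset.range N, c i ≤ ∑ i ∈ Finset.range (N + 1), c i :=
          Finset.sum_le_sum_of_subset_of_nonneg (Finset.range_subset_range.2 (Nat.le_succ N)) fun i _ _ ↦ hc0 i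
      _ = ∑ i ∈ Finset.Icc 1 N, c i :=
          DirichletMVT.sum_range_succ_eq_sum_Icc (fun i ↦ c i) (by simp [hc]) N
      _ ≤ 13 * (Real.log 4 + 4) * x := sum_Icc_montgomeryCoeff_le hx N
  rw [hswap]
  calc ‖∑' n, ∫ t in (0 : ℝ)..T, F n t‖ ≤ ∑' n, ‖∫ t in (0 : ℝ)..T, F n t‖ :=
        norm_tsum_le_tsum_norm (hsumterm.of_nonneg_of_le (fun n ↦ norm_nonneg _) hterm)
    _ ≤ ∑' n, 2 / Real.log 2 * Real.log (T + 2) * c n :=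
        (hsumterm.of_nonneg_of_le (fun n ↦ norm_nonneg _) hterm).tsum_le_tsum hterm hsumterm
    _ = 2 / Real.log 2 * Real.log (T + 2) * ∑' n, c n := tsum_mul_left
    _ ≤ 2 / Real.log 2 * Real.log (T + 2) * (13 * (Real.log 4 + 4) * x) :=
        mul_le_mul_of_nonneg_left htsumc (by positivity)
    _ = 2 / Real.log 2 * (13 * (Real.log 4 + 4)) * x * Real.log (T + 2) := by ring

/-! ## §3. The `R`-side on the window `[T, 2T]` -/

/-- `S_u(x,·)` is continuous on `ℝ` (`x ≥ 1`). [cite: BaluyotEtAl2024, §2 (trivialestimate)] -/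
theorem continuous_zeroKernelSeries {x : ℝ} (hx : 1 ≤ x) : Continuous fun t : ℝ ↦ zeroKernelSeries x t :=
  continuous_iff_continuousAt.2 fun t ↦
    (continuousOn_zeroKernelSeries hx (t - 1) (t + 1)).continuousAt (Icc_mem_nhds (by linarith) (by linarith))

/-- `⟨c, z⟩_ℝ = c · Re z` for real `c`. [folklore] -/
private theorem inner_ofReal_left (c : ℝ) (z : ℂ) : inner ℝ (c : ℂ) z = c * z.re := by
  simp [Complex.inner, mul_comm]

/-- For complex `a, g, r` and positive `q, s`:
`|‖−a+g+r‖² − ‖a‖² − ‖g‖² + 2⟨g,a⟩| ≤ (q‖a‖² + ‖r‖²/q) + (s‖g‖² + ‖r‖²/s) + ‖r‖²`. [folklore] -/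
private theorem abs_norm_sq_three_sub_add_le (a g r : ℂ) {q s : ℝ} (hq : 0 < q) (hs : 0 < s) :
    |‖-a + g + r‖ ^ 2 - ‖a‖ ^ 2 - ‖g‖ ^ 2 + 2 * inner ℝ g a| ≤
      (q * ‖a‖ ^ 2 + ‖r‖ ^ 2 / q) + (s * ‖g‖ ^ 2 + ‖r‖ ^ 2 / s) + ‖r‖ ^ 2 := by
  have e1 : ‖-a + g + r‖ ^ 2 = ‖g - a‖ ^ 2 + 2 * inner ℝ (g - a) r + ‖r‖ ^ 2 := by
    rw [show -a + g = g - a by ring]; exact norm_add_sq_real _ _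
  have e2 : ‖g - a‖ ^ 2 = ‖g‖ ^ 2 - 2 * inner ℝ g a + ‖a‖ ^ 2 := norm_sub_sq_real _ _
  have e3 : inner ℝ (g - a) r = inner ℝ g r - inner ℝ a r := inner_sub_left _ _ _
  have b2 : |inner ℝ g r| ≤ ‖g‖ * ‖r‖ := abs_real_inner_le_norm _ _
  have b3 : |inner ℝ a r| ≤ ‖a‖ * ‖r‖ := abs_real_inner_le_norm _ _
  have c2 := two_mul_le_mul_sq_add_sq_div hq ‖a‖ ‖r‖
  have c3 := two_mul_le_mul_sq_add_sq_div hs ‖g‖ ‖r‖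
  rw [abs_le] at b2 b3 ⊢
  constructor <;> nlinarith [norm_nonneg a, norm_nonneg g, norm_nonneg r]

/-- Integrated form of `abs_norm_sq_three_sub_add_le` on `[a, b]`. [folklore] -/
private theorem abs_integral_norm_sq_three_sub_add_le {A G R : ℝ → ℂ} (hA : Continuous A)
    (hG : Continuous G) (hR : Continuous R) {a b : ℝ} (hab : a ≤ b) {q s : ℝ} (hq : 0 < q) (hs : 0 < s) :
    |(∫ t in a..b, ‖-A t + G t + R t‖ ^ 2) - (∫ t in a..b, ‖A t‖ ^ 2) -
        (∫ t in a..b, ‖G t‖ ^ 2) + 2 * ∫ t in a..b, inner ℝ (G t) (A t)| ≤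
      (q * (∫ t in a..b, ‖A t‖ ^ 2) + (∫ t in a..b, ‖R t‖ ^ 2) / q) +
        (s * (∫ t in a..b, ‖G t‖ ^ 2) + (∫ t in a..b, ‖R t‖ ^ 2) / s) +
        (∫ t in a..b, ‖R t‖ ^ 2) := by
  have iA : IntervalIntegrable (fun t ↦ ‖A t‖ ^ 2) volume a b :=
    (by fun_prop : Continuous fun t ↦ ‖A t‖ ^ 2).intervalIntegrable a b
  have iG : IntervalIntegrable (fun t ↦ ‖G t‖ ^ 2) volume a b :=
    (by fun_prop : Continuous fun t ↦ ‖G t‖ ^ 2).intervalIntegrable a b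
  have iR : IntervalIntegrable (fun t ↦ ‖R t‖ ^ 2) volume a b :=
    (by fun_prop : Continuous fun t ↦ ‖R t‖ ^ 2).intervalIntegrable a b
  have iΦ : IntervalIntegrable (fun t ↦ ‖-A t + G t + R t‖ ^ 2) volume a b :=
    (by fun_prop : Continuous fun t ↦ ‖-A t + G t + R t‖ ^ 2).intervalIntegrable a b
  have iX : IntervalIntegrable (fun t ↦ inner ℝ (G t) (A t)) volume a b :=
    (hG.inner hA).intervalIntegrable a b
  have hdiff : (∫ t in a..b, ‖-A t + G t + R t‖ ^ 2) - (∫ t in a..b, ‖A t‖ ^ 2) -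
      (∫ t in a..b, ‖G t‖ ^ 2) + 2 * ∫ t in a..b, inner ℝ (G t) (A t) =
        ∫ t in a..b, (‖-A t + G t + R t‖ ^ 2 - ‖A t‖ ^ 2 - ‖G t‖ ^ 2 + 2 * inner ℝ (G t) (A t)) := by
    rw [intervalIntegral.integral_add ((iΦ.sub iA).sub iG) (iX.const_mul 2),
      intervalIntegral.integral_sub (iΦ.sub iA) iG, intervalIntegral.integral_sub iΦ iA,
      intervalIntegral.integral_const_mul]
  set bound : ℝ → ℝ := fun t ↦
    (q * ‖A t‖ ^ 2 + ‖R t‖ ^ 2 / q) + (s * ‖G t‖ ^ 2 + ‖R t‖ ^ 2 / s) + ‖R t‖ ^ 2 with hbound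
  have ibound : IntervalIntegrable bound volume a b := by
    rw [hbound]
    exact (by fun_prop : Continuous fun t ↦ (q * ‖A t‖ ^ 2 + ‖R t‖ ^ 2 / q) +
      (s * ‖G t‖ ^ 2 + ‖R t‖ ^ 2 / s) + ‖R t‖ ^ 2).intervalIntegrable a b
  have hle : ‖∫ t in a..b, (‖-A t + G t + R t‖ ^ 2 - ‖A t‖ ^ 2 - ‖G t‖ ^ 2 +
      2 * inner ℝ (G t) (A t))‖ ≤ ∫ t in a..b, bound t :=
    intervalIntegral.norm_integral_le_of_norm_le hab (Eventually.of_forall fun t _ ↦ by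
      rw [Real.norm_eq_abs]; exact abs_norm_sq_three_sub_add_le _ _ _ hq hs) ibound
  rw [hdiff, ← Real.norm_eq_abs]
  refine hle.trans (le_of_eq ?_)
  rw [hbound]
  simp only
  have iGs : IntervalIntegrable (fun t ↦ s * ‖G t‖ ^ 2) volume a b := iG.const_mul s
  have iRq : IntervalIntegrable (fun t ↦ ‖R t‖ ^ 2 / q) volume a b := iR.div_const q
  have iRs : IntervalIntegrable (fun t ↦ ‖R t‖ ^ 2 / s) volume a b := iR.div_const s
  have iAq : IntervalIntegrable (fun t ↦ q * ‖A t‖ ^ 2) volume a b := iA.const_mul q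
  rw [intervalIntegral.integral_add ((iAq.add iRq).add (iGs.add iRs)) iR,
    intervalIntegral.integral_add (iAq.add iRq) (iGs.add iRs), intervalIntegral.integral_add iAq iRq,
    intervalIntegral.integral_add iGs iRs, intervalIntegral.integral_const_mul,
    intervalIntegral.integral_const_mul, intervalIntegral.integral_div, intervalIntegral.integral_div]

/-- `∫_0^{2T} log²(t+2) − ∫_0^T log²(t+2) = T log² T + O(T log T)`: for `T ≥ 4`,
`|(J(2T) − J(T)) − T log²T| ≤ 254 T log T`. [folklore] -/
private theorem abs_integral_log_sq_window_sub_le {T : ℝ} (hT : 4 ≤ T) :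
    |((∫ t in (0 : ℝ)..(2 * T), Real.log (t + 2) ^ 2) - ∫ t in (0 : ℝ)..T, Real.log (t + 2) ^ 2) -
        T * Real.log T ^ 2| ≤ 254 * T * Real.log T := by
  have hT0 : 0 < T := by linarith
  have h1 := abs_integral_log_add_two_sq_sub_le (T := 2 * T) (by linarith)
  have h2 := abs_integral_log_add_two_sq_sub_le (T := T) (by linarith)
  have hlog1 : 1 ≤ Real.log T := by
    rw [← Real.log_exp 1]
    exact Real.log_le_log (Real.exp_pos 1) (by linarith [Real.exp_one_lt_d9])
  have hl2 : Real.log 2 < 0.7 := by linarith [Real.log_two_lt_d9]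
  have hl20 : 0 < Real.log 2 := Real.log_pos (by norm_num)
  have hlog2T : Real.log (2 * T) = Real.log 2 + Real.log T := Real.log_mul (by norm_num) hT0.ne'
  rw [hlog2T] at h1
  rw [abs_le] at h1 h2 ⊢
  constructor <;> nlinarith [h1.1, h1.2, h2.1, h2.2]

/-- The bookkeeping of `rside_window`: pure real arithmetic (no `nlinarith`/`positivity` search:
the context is large). [folklore] -/
private theorem rside_bookkeeping {T x sL IA IG IR IX Φ C₁ C₃ K₄ P : ℝ} (hT : 4 ≤ T) (hx : 1 ≤ x)
    (hxT : x ≤ T) (hsL0 : 0 < sL) (hsL1 : 1 ≤ sL) (hsL2 : sL ^ 2 = Real.log T)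
    (hlogT : Real.log T ≤ T) (hlog1 : 1 ≤ Real.log T) (hlx : 0 ≤ Real.log x)
    (hlxT : Real.log x ≤ Real.log T) (hK₄0 : 0 ≤ K₄)
    (hP : P = T * x + x ^ 2 + x * Real.sqrt (x * T * (Real.log x + 1)))
    (hIRb : IR ≤ 342 * x ^ 2 + 16 * C₁ ^ 2 * T / x)
    (hIAb : |IA - T * x * Real.log x| ≤ 3 * |C₃| * P)
    (hIGb : |IG - T / x * Real.log T ^ 2| ≤ 254 * (T / x) * Real.log T)
    (hIXb : |IX| ≤ 2 * K₄ * x * Real.log (2 * T + 2))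
    (h5 : ∀ q s : ℝ, 0 < q → 0 < s →
      |Φ - IA - IG + 2 * IX| ≤ (q * IA + IR / q) + (s * IG + IR / s) + IR) :
    |Φ - (T * x * Real.log x + T / x * Real.log T ^ 2)| ≤
      (2600 + 20 * |C₃| + 8 * K₄ + 80 * C₁ ^ 2) * (T * sL ^ 3 / x + x * T * sL) := by
  -- basic signs
  have hx0 : 0 < x := by linarith only [hx]
  have hT0 : 0 < T := by linarith only [hT]
  have hxT0 : 0 ≤ x * T := (mul_pos hx0 hT0).le
  have hsL30 : 0 < sL ^ 3 := pow_pos hsL0 3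
  have hE1 : 0 ≤ T * sL ^ 3 / x := div_nonneg (mul_nonneg hT0.le hsL30.le) hx0.le
  have hE2 : 0 ≤ x * T * sL := mul_nonneg hxT0 hsL0.le
  have hC3 : 0 ≤ |C₃| := abs_nonneg _
  have hC1 : 0 ≤ C₁ ^ 2 := sq_nonneg _
  have hlx2 : 0 < Real.log x + 2 := by linarith only [hlx]
  have hq : 0 < sL / (Real.log x + 2) := div_pos hsL0 hlx2
  have hs : 0 < x / sL ^ 3 := div_pos hx0 hsL30
  have h5 := h5 (sL / (Real.log x + 2)) (x / sL ^ 3) hq hs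
  set E : ℝ := T * sL ^ 3 / x + x * T * sL with hE
  have hE0 : 0 ≤ E := by rw [hE]; exact add_nonneg hE1 hE2
  have hlog2T : Real.log (2 * T + 2) ≤ 2 * sL ^ 2 := by
    rw [hsL2]
    have h' : 2 * T + 2 ≤ T ^ 2 := by
      have := mul_le_mul_of_nonneg_right hT (by linarith only [hT] : 0 ≤ T - 2)
      rw [sq]; linarith only [this, hT]
    calc Real.log (2 * T + 2) ≤ Real.log (T ^ 2) := Real.log_le_log (by linarith only [hT]) h'
      _ = 2 * Real.log T := by rw [Real.log_pow]; norm_num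
  -- elementary comparisons
  have hx2 : x ^ 2 ≤ x * T := by rw [sq]; exact mul_le_mul_of_nonneg_left hxT hx0.le
  have hsLT : sL ^ 2 ≤ T := by rw [hsL2]; exact hlogT
  have hsL3 : sL ^ 2 ≤ sL ^ 3 := pow_le_pow_right₀ hsL1 (by norm_num)
  have hsL13 : 1 ≤ sL ^ 3 := one_le_pow₀ hsL1
  have c1 : T * x ≤ x * T * sL := by
    rw [mul_comm T x]; exact le_mul_of_one_le_right hxT0 hsL1
  have c2 : x ^ 2 ≤ x * T * sL := hx2.trans (le_mul_of_one_le_right hxT0 hsL1)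
  have c3 : T / x ≤ T * sL ^ 3 / x :=
    div_le_div_of_nonneg_right (le_mul_of_one_le_right hT0.le hsL13) hx0.le
  have c4 : T / x * sL ^ 2 ≤ T * sL ^ 3 / x := by
    rw [div_mul_eq_mul_div]
    exact div_le_div_of_nonneg_right (mul_le_mul_of_nonneg_left hsL3 hT0.le) hx0.le
  have c5 : x * sL ^ 3 ≤ x * T * sL := by
    have : sL ^ 3 ≤ T * sL := by
      rw [pow_succ]; exact mul_le_mul_of_nonneg_right hsLT hsL0.le
    calc x * sL ^ 3 ≤ x * (T * sL) := mul_le_mul_of_nonneg_left this hx0.le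
      _ = x * T * sL := by ring
  have c6 : x ^ 2 * sL ≤ x * T * sL := mul_le_mul_of_nonneg_right hx2 hsL0.le
  have c7 : T * sL ≤ x * T * sL := by
    rw [mul_assoc]; exact le_mul_of_one_le_left (mul_nonneg hT0.le hsL0.le) hx
  have c8 : T * sL ^ 3 / x ^ 2 ≤ T * sL ^ 3 / x :=
    div_le_div_of_nonneg_left (mul_nonneg hT0.le hsL30.le) hx0 (le_self_pow₀ hx two_ne_zero)
  -- the square root in `P`
  have hsqrt0 : 0 ≤ Real.sqrt (x * T * (Real.log x + 1)) := Real.sqrt_nonneg _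
  have hsqrt : Real.sqrt (x * T * (Real.log x + 1)) ≤ 2 * T * sL := by
    have h1 : x * T * (Real.log x + 1) ≤ (2 * T * sL) ^ 2 := by
      rw [mul_pow, mul_pow, hsL2]
      have s1 : x * T * (Real.log x + 1) ≤ x * T * (2 * Real.log T) :=
        mul_le_mul_of_nonneg_left (by linarith only [hlxT, hlog1]) hxT0
      have s2 : x * T * (2 * Real.log T) ≤ T * T * (2 * Real.log T) :=
        mul_le_mul_of_nonneg_right (mul_le_mul_of_nonneg_right hxT hT0.le) (by linarith only [hlog1])
      have s3 : 0 ≤ T * T * (2 * Real.log T) :=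
        mul_nonneg (mul_nonneg hT0.le hT0.le) (by linarith only [hlog1])
      linarith only [s1, s2, s3]
    calc Real.sqrt (x * T * (Real.log x + 1)) ≤ Real.sqrt ((2 * T * sL) ^ 2) := Real.sqrt_le_sqrt h1
      _ = 2 * T * sL := Real.sqrt_sq (mul_nonneg (mul_nonneg (by norm_num) hT0.le) hsL0.le)
  have hsq2 : Real.sqrt (x * T * (Real.log x + 1)) ≤ T * (Real.log x + 1) := by
    have hl1 : 1 ≤ Real.log x + 1 := by linarith only [hlx]
    have h1 : x * T * (Real.log x + 1) ≤ (T * (Real.log x + 1)) ^ 2 := by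
      rw [mul_pow]
      have h' : Real.log x + 1 ≤ (Real.log x + 1) ^ 2 := le_self_pow₀ hl1 two_ne_zero
      have hxT2 : x * T ≤ T ^ 2 := by rw [sq]; exact mul_le_mul_of_nonneg_right hxT hT0.le
      calc x * T * (Real.log x + 1) ≤ T ^ 2 * (Real.log x + 1) :=
            mul_le_mul_of_nonneg_right hxT2 (by linarith only [hlx])
        _ ≤ T ^ 2 * (Real.log x + 1) ^ 2 := mul_le_mul_of_nonneg_left h' (sq_nonneg T)
    calc Real.sqrt (x * T * (Real.log x + 1)) ≤ Real.sqrt ((T * (Real.log x + 1)) ^ 2) :=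
          Real.sqrt_le_sqrt h1
      _ = T * (Real.log x + 1) := Real.sqrt_sq (mul_nonneg hT0.le (by linarith only [hlx]))
  have hP0 : 0 ≤ P := by
    rw [hP]; exact add_nonneg (add_nonneg (by linarith only [hxT0]) (sq_nonneg x)) (mul_nonneg hx0.le hsqrt0)
  have hPE : P ≤ 4 * E := by
    have h1 := mul_le_mul_of_nonneg_left hsqrt hx0.le
    have e : x * (2 * T * sL) = 2 * (x * T * sL) := by ring
    rw [hP, hE]
    linarith only [h1, e, c1, c2, hE1]
  have hPlog : P ≤ 2 * (T * x * (Real.log x + 2)) := by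
    have h1 := mul_le_mul_of_nonneg_left hsq2 hx0.le
    have h0 : 0 ≤ T * x * Real.log x := mul_nonneg (mul_nonneg hT0.le hx0.le) hlx
    have e : x * (T * (Real.log x + 1)) = T * x * Real.log x + T * x := by ring
    have e2 : 2 * (T * x * (Real.log x + 2)) = 2 * (T * x * Real.log x) + 4 * (T * x) := by ring
    have e3 : x * T = T * x := mul_comm x T
    rw [hP, e2]
    linarith only [h1, e, hx2, h0, e3, hxT0]
  -- (b1) `|IA − Tx log x| ≤ 12|C₃| E`
  have b1 : |IA - T * x * Real.log x| ≤ 12 * |C₃| * E := by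
    calc |IA - T * x * Real.log x| ≤ 3 * |C₃| * P := hIAb
      _ ≤ 3 * |C₃| * (4 * E) := mul_le_mul_of_nonneg_left hPE (by linarith only [hC3])
      _ = 12 * |C₃| * E := by ring
  -- (b2) `|IG − (T/x) log²T| ≤ 254 E`
  have b2 : |IG - T / x * Real.log T ^ 2| ≤ 254 * E := by
    refine hIGb.trans ?_
    rw [← hsL2, hE]
    linarith only [c4, hE2]
  -- (b3) `|IX| ≤ 4K₄ E`
  have b3 : |IX| ≤ 4 * K₄ * E := by
    have hK4x : 0 ≤ 2 * K₄ * x := mul_nonneg (by linarith only [hK₄0]) hx0.le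
    have h1 : |IX| ≤ 2 * K₄ * x * (2 * sL ^ 2) := hIXb.trans (mul_le_mul_of_nonneg_left hlog2T hK4x)
    have h2 : x * sL ^ 2 ≤ x * T * sL := by
      calc x * sL ^ 2 = x * sL * sL := by ring
        _ ≤ x * T * sL := mul_le_mul_of_nonneg_right
            (mul_le_mul_of_nonneg_left (by linarith only [hsLT, hsL1, sq_nonneg (sL - 1)]) hx0.le) hsL0.le
    have h3 : 2 * K₄ * x * (2 * sL ^ 2) = 4 * K₄ * (x * sL ^ 2) := by ring
    have h4 := mul_le_mul_of_nonneg_left h2 (by linarith only [hK₄0] : 0 ≤ 4 * K₄)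
    have h5' := mul_le_mul_of_nonneg_left (show x * T * sL ≤ E by rw [hE]; linarith only [hE1])
      (by linarith only [hK₄0] : 0 ≤ 4 * K₄)
    linarith only [h1, h3, h4, h5']
  -- (b4) `q IA ≤ (1 + 6|C₃|) E`
  have hIAle : IA ≤ (1 + 6 * |C₃|) * (T * x * (Real.log x + 2)) := by
    have h1 := (abs_le.1 hIAb).2
    have h2 : T * x * Real.log x ≤ T * x * (Real.log x + 2) :=
      mul_le_mul_of_nonneg_left (by linarith only [hlx]) (mul_nonneg hT0.le hx0.le)
    have h3 := mul_le_mul_of_nonneg_left hPlog (by linarith only [hC3] : 0 ≤ 3 * |C₃|)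
    have e : 3 * |C₃| * (2 * (T * x * (Real.log x + 2))) = 6 * |C₃| * (T * x * (Real.log x + 2)) := by ring
    have e2 : (1 + 6 * |C₃|) * (T * x * (Real.log x + 2)) =
        T * x * (Real.log x + 2) + 6 * |C₃| * (T * x * (Real.log x + 2)) := by ring
    linarith only [h1, h2, h3, e, e2]
  have b4 : sL / (Real.log x + 2) * IA ≤ (1 + 6 * |C₃|) * E := by
    have hc0 : 0 ≤ 1 + 6 * |C₃| := by linarith only [hC3]
    calc sL / (Real.log x + 2) * IA
        ≤ sL / (Real.log x + 2) * ((1 + 6 * |C₃|) * (T * x * (Real.log x + 2))) :=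
          mul_le_mul_of_nonneg_left hIAle hq.le
      _ = (1 + 6 * |C₃|) * (x * T * sL) := by field_simp
      _ ≤ (1 + 6 * |C₃|) * E := by
          refine mul_le_mul_of_nonneg_left ?_ hc0
          rw [hE]; linarith only [hE1]
  -- (b5) `IR/q ≤ (1026 + 48 C₁²) E`
  have hlx3 : Real.log x + 2 ≤ 3 * sL ^ 2 := by rw [hsL2]; linarith only [hlxT, hlog1]
  have hIRB0 : 0 ≤ 342 * x ^ 2 + 16 * C₁ ^ 2 * T / x :=
    add_nonneg (mul_nonneg (by norm_num) (sq_nonneg x))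
      (div_nonneg (mul_nonneg (mul_nonneg (by norm_num) hC1) hT0.le) hx0.le)
  have b5 : IR / (sL / (Real.log x + 2)) ≤ (1026 + 48 * C₁ ^ 2) * E := by
    rw [div_div_eq_mul_div, div_le_iff₀ hsL0]
    have h1 : IR * (Real.log x + 2) ≤ (342 * x ^ 2 + 16 * C₁ ^ 2 * T / x) * (3 * sL ^ 2) :=
      mul_le_mul hIRb hlx3 hlx2.le hIRB0
    refine h1.trans ?_
    have e1 : (342 * x ^ 2 + 16 * C₁ ^ 2 * T / x) * (3 * sL ^ 2) =
        (1026 * (x ^ 2 * sL) + 48 * C₁ ^ 2 * (T / x * sL)) * sL := by ring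
    rw [e1]
    refine mul_le_mul_of_nonneg_right ?_ hsL0.le
    have h2 : T / x * sL ≤ T * sL ^ 3 / x := by
      rw [div_mul_eq_mul_div]
      refine div_le_div_of_nonneg_right (mul_le_mul_of_nonneg_left ?_ hT0.le) hx0.le
      calc sL = sL * 1 * 1 := by ring
        _ ≤ sL * sL * sL := mul_le_mul (mul_le_mul_of_nonneg_left hsL1 hsL0.le) hsL1 zero_le_one
            (mul_nonneg hsL0.le hsL0.le)
        _ = sL ^ 3 := by ring
    have h3 := mul_le_mul_of_nonneg_left h2 (mul_nonneg (by norm_num) hC1 : 0 ≤ 48 * C₁ ^ 2)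
    have h4 : 0 ≤ 48 * C₁ ^ 2 * (x * T * sL) := mul_nonneg (mul_nonneg (by norm_num) hC1) hE2
    have h5' : 0 ≤ 1026 * (T * sL ^ 3 / x) := mul_nonneg (by norm_num) hE1
    rw [hE]
    linarith only [c6, h3, h4, h5']
  -- (b6) `s IG ≤ 255 E`
  have hIGle : IG ≤ 255 * (T / x) * sL ^ 4 := by
    have h1 := (abs_le.1 hIGb).2
    rw [← hsL2] at h1
    have hTx : 0 ≤ T / x := div_nonneg hT0.le hx0.le
    have h2 : T / x * sL ^ 2 ≤ T / x * sL ^ 4 :=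
      mul_le_mul_of_nonneg_left (pow_le_pow_right₀ hsL1 (by norm_num)) hTx
    have h3 : T / x * (sL ^ 2) ^ 2 = T / x * sL ^ 4 := by ring
    linarith only [h1, h2, h3]
  have b6 : x / sL ^ 3 * IG ≤ 255 * E := by
    calc x / sL ^ 3 * IG ≤ x / sL ^ 3 * (255 * (T / x) * sL ^ 4) :=
          mul_le_mul_of_nonneg_left hIGle hs.le
      _ = 255 * (T * sL) := by field_simp
      _ ≤ 255 * E := by rw [hE]; linarith only [c7, hE1]
  -- (b7) `IR/s ≤ (342 + 16 C₁²) E`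
  have b7 : IR / (x / sL ^ 3) ≤ (342 + 16 * C₁ ^ 2) * E := by
    rw [div_div_eq_mul_div, div_le_iff₀ hx0]
    calc IR * sL ^ 3 ≤ (342 * x ^ 2 + 16 * C₁ ^ 2 * T / x) * sL ^ 3 :=
          mul_le_mul_of_nonneg_right hIRb hsL30.le
      _ = (342 * (x * sL ^ 3) + 16 * C₁ ^ 2 * (T * sL ^ 3 / x ^ 2)) * x := by field_simp
      _ ≤ ((342 + 16 * C₁ ^ 2) * E) * x := by
          refine mul_le_mul_of_nonneg_right ?_ hx0.le
          have h3 := mul_le_mul_of_nonneg_left c8 (mul_nonneg (by norm_num) hC1 : 0 ≤ 16 * C₁ ^ 2)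
          have h4 : 0 ≤ 16 * C₁ ^ 2 * (x * T * sL) := mul_nonneg (mul_nonneg (by norm_num) hC1) hE2
          have h5' : 0 ≤ 342 * (T * sL ^ 3 / x) := mul_nonneg (by norm_num) hE1
          rw [hE]
          linarith only [c5, h3, h4, h5']
  -- (b8) `IR ≤ (342 + 16 C₁²) E`
  have b8 : IR ≤ (342 + 16 * C₁ ^ 2) * E := by
    refine hIRb.trans ?_
    have h3 : 16 * C₁ ^ 2 * T / x = 16 * C₁ ^ 2 * (T / x) := by ring
    have h4 := mul_le_mul_of_nonneg_left c3 (mul_nonneg (by norm_num) hC1 : 0 ≤ 16 * C₁ ^ 2)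
    have h5' : 0 ≤ 16 * C₁ ^ 2 * (x * T * sL) := mul_nonneg (mul_nonneg (by norm_num) hC1) hE2
    have h6 : 0 ≤ 342 * (T * sL ^ 3 / x) := mul_nonneg (by norm_num) hE1
    rw [hE, h3]
    linarith only [c2, h4, h5', h6]
  -- assemble
  have hB : sL / (Real.log x + 2) * IA + IR / (sL / (Real.log x + 2)) +
      (x / sL ^ 3 * IG + IR / (x / sL ^ 3)) + IR ≤ (1966 + 6 * |C₃| + 80 * C₁ ^ 2) * E := by
    linarith only [b4, b5, b6, b7, b8]
  have hC3E : 0 ≤ |C₃| * E := mul_nonneg hC3 hE0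
  have hC1E : 0 ≤ C₁ ^ 2 * E := mul_nonneg hC1 hE0
  have hKE : 0 ≤ K₄ * E := mul_nonneg hK₄0 hE0
  rw [abs_le] at h5 b1 b2 b3 ⊢
  constructor <;> linarith only [h5.1, h5.2, b1.1, b1.2, b2.1, b2.2, b3.1, b3.2, hB, hC3E, hC1E, hKE, hE0]

/-- **The `R`-side of the explicit formula in mean square over `[T, 2T]`** (BGST 2024, proof of
Theorem 1: "`R(x,T) = x⁻²T log T(log T + O(1)) + T(log x + O(√log T))`", on the dyadic window and
multiplied by `x`): there is `C` such that for `T ≥ 4` and `1 ≤ x ≤ T`,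
`|∫_T^{2T} |2x^{1/2−it}S_u(x,t)|² dt − (Tx log x + (T/x) log²T)| ≤ C (T log^{3/2}T/x + xT√log T)`.
Ingredients: Lemma 1 (`baluyotEtAl2024_lemma1`), (P3♯) (`Montgomery.exists_meanSquare_dirichletSum_sharp`)
at `2T` and `T`, the cross term of §2, and the `L²` algebra with the weights `q = √log T/(log x+2)`,
`s = x/log^{3/2}T`. [cite: BaluyotEtAl2025, §3 (proof of Theorem 1 in [BGST-PC])] -/
theorem rside_window : ∃ C : ℝ, 0 ≤ C ∧ ∀ T : ℝ, 4 ≤ T → ∀ x : ℝ, 1 ≤ x → x ≤ T →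
    |(∫ t in T..(2 * T), ‖2 * (x : ℂ) ^ ((1 / 2 : ℂ) - t * I) * zeroKernelSeries x t‖ ^ 2) -
        (T * x * Real.log x + T / x * Real.log T ^ 2)| ≤
      C * (T * Real.sqrt (Real.log T) ^ 3 / x + x * T * Real.sqrt (Real.log T)) := by
  obtain ⟨C₁, hC₁⟩ := baluyotEtAl2024_lemma1
  obtain ⟨C₃, hC₃⟩ := exists_meanSquare_dirichletSum_sharp
  obtain ⟨K₄, hK₄0, hK₄⟩ := exists_norm_integral_log_mul_dirichletSum_le
  refine ⟨2600 + 20 * |C₃| + 8 * K₄ + 80 * C₁ ^ 2, by positivity, fun T hT x hx hxT ↦ ?_⟩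
  have hx0 : 0 < x := by linarith
  have hx0' : (x : ℂ) ≠ 0 := ofReal_ne_zero.2 hx0.ne'
  have hT0 : 0 < T := by linarith
  have hT2 : (2 : ℝ) ≤ T := by linarith
  have hTT : T ≤ 2 * T := by linarith
  have hlog : 0 < Real.log T := Real.log_pos (by linarith)
  have hlog1 : 1 ≤ Real.log T := by
    rw [← Real.log_exp 1]
    exact Real.log_le_log (Real.exp_pos 1) (by linarith [Real.exp_one_lt_d9])
  have hlogT : Real.log T ≤ T := by linarith [Real.log_le_sub_one_of_pos hT0]
  have hlx : 0 ≤ Real.log x := Real.log_nonneg hx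
  have hlxT : Real.log x ≤ Real.log T := Real.log_le_log hx0 hxT
  set sL : ℝ := Real.sqrt (Real.log T) with hsL
  have hsL0 : 0 < sL := Real.sqrt_pos.2 hlog
  have hsL2 : sL ^ 2 = Real.log T := Real.sq_sqrt hlog.le
  have hsL1 : 1 ≤ sL := by rw [hsL]; exact Real.one_le_sqrt.2 hlog1
  clear_value sL
  -- the Lemma-1 constant is non-negative
  have hC₁0 : 0 ≤ C₁ := by
    obtain ⟨E₁, E₂, hE₁, -, -⟩ := hC₁ x hx 0
    exact (norm_nonneg _).trans hE₁
  -- the functions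
  set A : ℝ → ℂ := montgomeryDirichletSum x with hA
  set L : ℝ → ℂ := fun t ↦ 2 * (x : ℂ) ^ ((1 / 2 : ℂ) - t * I) * zeroKernelSeries x t with hL
  set gR : ℝ → ℝ := fun t ↦ x ^ (-(1 / 2) : ℝ) * Real.log (|t| + 2) with hgR
  set G : ℝ → ℂ := fun t ↦ (gR t : ℂ) with hG
  have hGeq : ∀ t : ℝ, G t = (x : ℂ) ^ (-(1 / 2 : ℂ)) * (Real.log (|t| + 2) : ℂ) := by
    intro t
    simp only [hG, hgR]
    rw [Complex.ofReal_mul, Complex.ofReal_cpow hx0.le]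
    push_cast
    ring_nf
  set R : ℝ → ℂ := fun t ↦ L t + A t - G t with hR
  have hAc : Continuous A := continuous_montgomeryDirichletSum hx0
  have hLc : Continuous L :=
    (continuous_const.mul (Continuous.const_cpow (by fun_prop) (Or.inl hx0'))).mul
      (continuous_zeroKernelSeries hx)
  have hgRc : Continuous gR := by
    simp only [hgR]
    exact continuous_const.mul (Continuous.log (by fun_prop) fun t ↦ by positivity)
  have hGc : Continuous G := Complex.continuous_ofReal.comp hgRc
  have hRc : Continuous R := (hLc.add hAc).sub hGc
  -- the pointwise bound on `R`
  set Cx : ℝ := C₁ * x ^ (-(1 / 2) : ℝ) with hCx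
  have hx12le : x ^ (-(1 / 2) : ℝ) ≤ 1 := Real.rpow_le_one_of_one_le_of_nonpos hx (by norm_num)
  have hx12pos : 0 < x ^ (-(1 / 2) : ℝ) := Real.rpow_pos_of_pos hx0 _
  have hCx0 : 0 ≤ Cx := by rw [hCx]; positivity
  have hRb : ∀ t : ℝ, ‖R t‖ ≤ 64 * x / (|t| + 2) ^ 2 + 2 * Cx := by
    intro t
    obtain ⟨E₁, E₂, hE₁, hE₂, heq⟩ := hC₁ x hx t
    have hRt : R t = 2 * (x : ℂ) ^ ((1 : ℂ) - t * I) / ((1 / 2 + t * I) * (3 / 2 - t * I)) +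
        (x : ℂ) ^ (-(1 / 2 : ℂ)) * E₁ + E₂ := by
      simp only [hR, hL, hA, heq, hGeq t]; ring
    have hx12 : ‖(x : ℂ) ^ (-(1 / 2 : ℂ))‖ = x ^ (-(1 / 2) : ℝ) := by
      rw [norm_cpow_eq_rpow_re_of_pos hx0]; congr 1; simp
    have hE₂' : ‖E₂‖ ≤ Cx := by
      have h1 : x ^ (-2 : ℝ) ≤ x ^ (-(1 / 2) : ℝ) := Real.rpow_le_rpow_of_exponent_le hx (by norm_num)
      have h2 : x ^ (-2 : ℝ) / (|t| + 2) ≤ x ^ (-(1 / 2) : ℝ) :=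
        (div_le_self (Real.rpow_nonneg hx0.le _) (by linarith [abs_nonneg t])).trans h1
      rw [hCx]
      exact hE₂.trans (mul_le_mul_of_nonneg_left h2 hC₁0)
    have hmid : ‖(x : ℂ) ^ (-(1 / 2 : ℂ)) * E₁‖ ≤ Cx := by
      rw [norm_mul, hx12, hCx, mul_comm]
      exact mul_le_mul_of_nonneg_right hE₁ hx12pos.le
    rw [hRt]
    calc ‖2 * (x : ℂ) ^ ((1 : ℂ) - t * I) / ((1 / 2 + t * I) * (3 / 2 - t * I)) +
          (x : ℂ) ^ (-(1 / 2 : ℂ)) * E₁ + E₂‖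
        ≤ ‖2 * (x : ℂ) ^ ((1 : ℂ) - t * I) / ((1 / 2 + t * I) * (3 / 2 - t * I)) +
          (x : ℂ) ^ (-(1 / 2 : ℂ)) * E₁‖ + ‖E₂‖ := norm_add_le _ _
      _ ≤ (‖2 * (x : ℂ) ^ ((1 : ℂ) - t * I) / ((1 / 2 + t * I) * (3 / 2 - t * I))‖ +
          ‖(x : ℂ) ^ (-(1 / 2 : ℂ)) * E₁‖) + ‖E₂‖ := by gcongr; exact norm_add_le _ _
      _ ≤ (64 * x / (|t| + 2) ^ 2 + Cx) + Cx := by gcongr; exact norm_mainTermB_le hx0 t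
      _ = 64 * x / (|t| + 2) ^ 2 + 2 * Cx := by ring
  -- the integrals over the window
  set IA : ℝ := ∫ t in T..(2 * T), ‖A t‖ ^ 2 with hIA
  set IG : ℝ := ∫ t in T..(2 * T), ‖G t‖ ^ 2 with hIG
  set IR : ℝ := ∫ t in T..(2 * T), ‖R t‖ ^ 2 with hIR
  set IX : ℝ := ∫ t in T..(2 * T), inner ℝ (G t) (A t) with hIX
  have hIL : ∫ t in T..(2 * T), ‖-A t + G t + R t‖ ^ 2 =
      ∫ t in T..(2 * T), ‖2 * (x : ℂ) ^ ((1 / 2 : ℂ) - t * I) * zeroKernelSeries x t‖ ^ 2 := by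
    refine intervalIntegral.integral_congr fun t _ ↦ ?_
    have : -A t + G t + R t = L t := by simp only [hR]; ring
    simp only [this, hL]
  -- `IR ≤ ∫_0^{2T} ‖R‖² ≤ 342 x² + 16 C₁² T/x`
  have hIRb : IR ≤ 342 * x ^ 2 + 16 * C₁ ^ 2 * T / x := by
    have h2T := integral_norm_sq_remainder_le hRc hx0 hRb (T := 2 * T) (by linarith)
    have hsplit : (∫ t in (0 : ℝ)..T, ‖R t‖ ^ 2) + (∫ t in T..(2 * T), ‖R t‖ ^ 2) =
        ∫ t in (0 : ℝ)..(2 * T), ‖R t‖ ^ 2 :=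
      intervalIntegral.integral_add_adjacent_intervals
        (((by fun_prop : Continuous fun t ↦ ‖R t‖ ^ 2)).intervalIntegrable 0 T)
        (((by fun_prop : Continuous fun t ↦ ‖R t‖ ^ 2)).intervalIntegrable T (2 * T))
    have h0T : 0 ≤ ∫ t in (0 : ℝ)..T, ‖R t‖ ^ 2 :=
      intervalIntegral.integral_nonneg hT0.le fun t _ ↦ by positivity
    have hCx2 : Cx ^ 2 = C₁ ^ 2 * x⁻¹ := by
      rw [hCx, mul_pow, ← Real.rpow_natCast (x ^ (-(1 / 2) : ℝ)), ← Real.rpow_mul hx0.le,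
        ← Real.rpow_neg_one]
      norm_num
    rw [hCx2] at h2T
    have e : 342 * x ^ 2 + 8 * (C₁ ^ 2 * x⁻¹) * (2 * T) = 342 * x ^ 2 + 16 * C₁ ^ 2 * T / x := by
      field_simp; ring
    linarith
  -- `IA = ∫_0^{2T} − ∫_0^T`, (P3♯) twice
  set P : ℝ := T * x + x ^ 2 + x * Real.sqrt (x * T * (Real.log x + 1)) with hP
  have hP0 : 0 ≤ P := by positivity
  have hIAb : |IA - T * x * Real.log x| ≤ 3 * |C₃| * P := by
    have hsplit : (∫ t in (0 : ℝ)..T, ‖A t‖ ^ 2) + (∫ t in T..(2 * T), ‖A t‖ ^ 2) =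
        ∫ t in (0 : ℝ)..(2 * T), ‖A t‖ ^ 2 :=
      intervalIntegral.integral_add_adjacent_intervals
        (((by fun_prop : Continuous fun t ↦ ‖A t‖ ^ 2)).intervalIntegrable 0 T)
        (((by fun_prop : Continuous fun t ↦ ‖A t‖ ^ 2)).intervalIntegrable T (2 * T))
    have h2 := hC₃ x hx (2 * T) (by linarith)
    have h1 := hC₃ x hx T hT
    have hle2 : C₃ * (2 * T * x + x ^ 2 + x * Real.sqrt (x * (2 * T) * (Real.log x + 1))) ≤ 2 * |C₃| * P := by
      have hsq : Real.sqrt (x * (2 * T) * (Real.log x + 1)) ≤ 2 * Real.sqrt (x * T * (Real.log x + 1)) := by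
        rw [show x * (2 * T) * (Real.log x + 1) = 2 * (x * T * (Real.log x + 1)) by ring,
          Real.sqrt_mul' _ (by positivity : 0 ≤ x * T * (Real.log x + 1))]
        refine mul_le_mul_of_nonneg_right ?_ (Real.sqrt_nonneg _)
        rw [show (2 : ℝ) = Real.sqrt 4 by rw [show (4:ℝ) = 2 ^ 2 by norm_num, Real.sqrt_sq (by norm_num)]]
        exact Real.sqrt_le_sqrt (by norm_num)
      have hb : 2 * T * x + x ^ 2 + x * Real.sqrt (x * (2 * T) * (Real.log x + 1)) ≤ 2 * P := by
        have := mul_le_mul_of_nonneg_left hsq hx0.le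
        rw [hP]; nlinarith [this, sq_nonneg x]
      have hb0 : 0 ≤ 2 * T * x + x ^ 2 + x * Real.sqrt (x * (2 * T) * (Real.log x + 1)) := by positivity
      calc C₃ * (2 * T * x + x ^ 2 + x * Real.sqrt (x * (2 * T) * (Real.log x + 1)))
          ≤ |C₃| * (2 * T * x + x ^ 2 + x * Real.sqrt (x * (2 * T) * (Real.log x + 1))) :=
            mul_le_mul_of_nonneg_right (le_abs_self _) hb0
        _ ≤ |C₃| * (2 * P) := mul_le_mul_of_nonneg_left hb (abs_nonneg _)
        _ = 2 * |C₃| * P := by ring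
    have hle1 : C₃ * P ≤ |C₃| * P := mul_le_mul_of_nonneg_right (le_abs_self _) hP0
    have hIAeq : IA - T * x * Real.log x =
        ((∫ t in (0 : ℝ)..(2 * T), ‖A t‖ ^ 2) - 2 * T * x * Real.log x) -
          ((∫ t in (0 : ℝ)..T, ‖A t‖ ^ 2) - T * x * Real.log x) := by
      rw [hIA]; linarith
    rw [hIAeq]
    refine (abs_sub _ _).trans ?_
    linarith [h2.trans hle2, h1.trans hle1]
  -- `IG = x⁻¹ (J(2T) − J(T))`
  have hIGb : |IG - T / x * Real.log T ^ 2| ≤ 254 * (T / x) * Real.log T := by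
    have hfun : (fun t ↦ ‖G t‖ ^ 2) = fun t ↦ ‖(x : ℂ) ^ (-(1 / 2 : ℂ)) * (Real.log (|t| + 2) : ℂ)‖ ^ 2 :=
      funext fun t ↦ by rw [hGeq t]
    have hsplit : (∫ t in (0 : ℝ)..T, ‖G t‖ ^ 2) + (∫ t in T..(2 * T), ‖G t‖ ^ 2) =
        ∫ t in (0 : ℝ)..(2 * T), ‖G t‖ ^ 2 :=
      intervalIntegral.integral_add_adjacent_intervals
        (((by fun_prop : Continuous fun t ↦ ‖G t‖ ^ 2)).intervalIntegrable 0 T)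
        (((by fun_prop : Continuous fun t ↦ ‖G t‖ ^ 2)).intervalIntegrable T (2 * T))
    have h2 : ∫ t in (0 : ℝ)..(2 * T), ‖G t‖ ^ 2 = x⁻¹ * ∫ t in (0 : ℝ)..(2 * T), Real.log (t + 2) ^ 2 := by
      rw [hfun]; exact integral_norm_sq_cpow_neg_half_mul_log hx0 (by linarith)
    have h1 : ∫ t in (0 : ℝ)..T, ‖G t‖ ^ 2 = x⁻¹ * ∫ t in (0 : ℝ)..T, Real.log (t + 2) ^ 2 := by
      rw [hfun]; exact integral_norm_sq_cpow_neg_half_mul_log hx0 hT0.le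
    have hJ := abs_integral_log_sq_window_sub_le hT
    have hIGeq : IG = x⁻¹ * (((∫ t in (0 : ℝ)..(2 * T), Real.log (t + 2) ^ 2) -
        ∫ t in (0 : ℝ)..T, Real.log (t + 2) ^ 2)) := by
      rw [hIG, mul_sub, ← h1, ← h2]; linarith
    rw [hIGeq, show T / x * Real.log T ^ 2 = x⁻¹ * (T * Real.log T ^ 2) by ring, ← mul_sub, abs_mul,
      abs_of_pos (inv_pos.2 hx0), show 254 * (T / x) * Real.log T = x⁻¹ * (254 * T * Real.log T) by ring]
    exact mul_le_mul_of_nonneg_left hJ (inv_pos.2 hx0).le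
  -- the cross term
  have hIXb : |IX| ≤ 2 * K₄ * x * Real.log (2 * T + 2) := by
    set CI : ℂ := ∫ t in T..(2 * T), (Real.log (t + 2) : ℂ) * A t with hCI
    have hint : ∀ a b : ℝ, 0 ≤ a → a ≤ b →
        IntervalIntegrable (fun t ↦ (Real.log (t + 2) : ℂ) * A t) volume a b := by
      intro a b ha hab
      refine ((Complex.continuous_ofReal.comp_continuousOn ?_).mul hAc.continuousOn).intervalIntegrable
      exact ContinuousOn.log (by fun_prop) fun t ht ↦ by
        rw [Set.uIcc_of_le hab] at ht; linarith [ht.1]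
    have hIXeq : IX = x ^ (-(1 / 2) : ℝ) * CI.re := by
      have h1 : IX = ∫ t in T..(2 * T), x ^ (-(1 / 2) : ℝ) * ((Real.log (t + 2) : ℂ) * A t).re := by
        rw [hIX]
        refine intervalIntegral.integral_congr fun t ht ↦ ?_
        rw [Set.uIcc_of_le hTT] at ht
        have ht0 : 0 ≤ t := by linarith [ht.1]
        simp only [hG, hgR, inner_ofReal_left, Complex.re_ofReal_mul, abs_of_nonneg ht0]
        ring
      rw [h1, intervalIntegral.integral_const_mul]
      congr 1
      have := Complex.reCLM.intervalIntegral_comp_comm (hint T (2 * T) hT0.le hTT)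
      simpa using this
    have hCIeq : CI = (∫ t in (0 : ℝ)..(2 * T), (Real.log (t + 2) : ℂ) * A t) -
        ∫ t in (0 : ℝ)..T, (Real.log (t + 2) : ℂ) * A t := by
      rw [hCI, ← intervalIntegral.integral_add_adjacent_intervals (hint 0 T le_rfl hT0.le)
        (hint T (2 * T) hT0.le hTT)]
      ring
    have hCIb : ‖CI‖ ≤ 2 * K₄ * x * Real.log (2 * T + 2) := by
      rw [hCIeq]
      have h2 := hK₄ x hx (2 * T) (by linarith)
      have h1 := hK₄ x hx T hT0.le
      have hlogle : Real.log (T + 2) ≤ Real.log (2 * T + 2) := Real.log_le_log (by linarith) (by linarith)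
      calc ‖(∫ t in (0 : ℝ)..(2 * T), (Real.log (t + 2) : ℂ) * A t) -
            ∫ t in (0 : ℝ)..T, (Real.log (t + 2) : ℂ) * A t‖
          ≤ K₄ * x * Real.log (2 * T + 2) + K₄ * x * Real.log (T + 2) :=
            (norm_sub_le _ _).trans (add_le_add h2 h1)
        _ ≤ 2 * K₄ * x * Real.log (2 * T + 2) := by
            have := mul_le_mul_of_nonneg_left hlogle (by positivity : 0 ≤ K₄ * x)
            linarith
    rw [hIXeq, abs_mul, abs_of_pos hx12pos]
    calc x ^ (-(1 / 2) : ℝ) * |CI.re| ≤ 1 * ‖CI‖ :=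
          mul_le_mul hx12le (Complex.abs_re_le_norm CI) (abs_nonneg _) zero_le_one
      _ ≤ 2 * K₄ * x * Real.log (2 * T + 2) := by rw [one_mul]; exact hCIb
  -- the `L²` algebra with `q = sL/(log x + 2)`, `s = x/sL³`, and the bookkeeping
  have h5 : ∀ q s : ℝ, 0 < q → 0 < s →
      |(∫ t in T..(2 * T), ‖2 * (x : ℂ) ^ ((1 / 2 : ℂ) - t * I) * zeroKernelSeries x t‖ ^ 2) -
          IA - IG + 2 * IX| ≤ (q * IA + IR / q) + (s * IG + IR / s) + IR := by
    intro q s hq hs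
    have h := abs_integral_norm_sq_three_sub_add_le hAc hGc hRc hTT hq hs
    rw [hIL] at h
    exact h
  exact rside_bookkeeping hT hx hxT hsL0 hsL1 hsL2 hlogT hlog1 hlx hlxT hK₄0 hP hIRb hIAb hIGb hIXb h5

/-! ## §4. Assembly: (MT) -/

/-- `(log T)³ ≤ … ` bookkeeping: for all large `T`, `√T log³(2T+2) ≤ T √log T` and
`log²(2T+2) ≤ T √log T`. [folklore] -/
private theorem eventually_log_window_le :
    ∀ᶠ T : ℝ in atTop, Real.sqrt T * Real.log (2 * T + 2) ^ 3 ≤ T * Real.sqrt (Real.log T) ∧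
      Real.log (2 * T + 2) ^ 2 ≤ T * Real.sqrt (Real.log T) := by
  have h6 := (Real.isLittleO_pow_log_id_atTop (n := 6)).def (by norm_num : (0 : ℝ) < 1 / 4096)
  have h2 := (Real.isLittleO_pow_log_id_atTop (n := 2)).def (by norm_num : (0 : ℝ) < 1 / 4)
  filter_upwards [h6, h2, eventually_ge_atTop 4] with T h6 h2 hT
  have hT0 : 0 < T := by linarith
  have hT1 : 1 < T := by linarith
  have hlog1 : 1 ≤ Real.log T := by
    rw [← Real.log_exp 1]
    exact Real.log_le_log (Real.exp_pos 1) (by linarith [Real.exp_one_lt_d9])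
  have hlog0 : 0 ≤ Real.log T := by linarith
  rw [id, Real.norm_of_nonneg (pow_nonneg hlog0 _), Real.norm_of_nonneg hT0.le] at h6 h2
  have hL : Real.log (2 * T + 2) ≤ 2 * Real.log T := by
    have h' : 2 * T + 2 ≤ T ^ 2 := by nlinarith
    calc Real.log (2 * T + 2) ≤ Real.log (T ^ 2) := Real.log_le_log (by linarith) h'
      _ = 2 * Real.log T := by rw [Real.log_pow]; norm_num
  have hL0 : 0 ≤ Real.log (2 * T + 2) := Real.log_nonneg (by linarith)
  have hsL1 : 1 ≤ Real.sqrt (Real.log T) := Real.one_le_sqrt.2 hlog1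
  constructor
  · -- `8 log³T ≤ √T / 8`, i.e. `64² log⁶T ≤ T`
    have h3 : Real.log (2 * T + 2) ^ 3 ≤ 8 * Real.log T ^ 3 := by
      have := pow_le_pow_left₀ hL0 hL 3; nlinarith
    have h4 : 8 * Real.log T ^ 3 ≤ Real.sqrt T := by
      have h5 : (8 * Real.log T ^ 3) ^ 2 ≤ T := by nlinarith
      calc 8 * Real.log T ^ 3 = Real.sqrt ((8 * Real.log T ^ 3) ^ 2) := (Real.sqrt_sq (by positivity)).symm
        _ ≤ Real.sqrt T := Real.sqrt_le_sqrt h5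
    have hsT : Real.sqrt T * Real.sqrt T = T := Real.mul_self_sqrt hT0.le
    calc Real.sqrt T * Real.log (2 * T + 2) ^ 3 ≤ Real.sqrt T * Real.sqrt T :=
          mul_le_mul_of_nonneg_left (h3.trans h4) (Real.sqrt_nonneg T)
      _ = T * 1 := by rw [hsT, mul_one]
      _ ≤ T * Real.sqrt (Real.log T) := mul_le_mul_of_nonneg_left hsL1 hT0.le
  · have h3 : Real.log (2 * T + 2) ^ 2 ≤ 4 * Real.log T ^ 2 := by
      have := pow_le_pow_left₀ hL0 hL 2; nlinarith
    calc Real.log (2 * T + 2) ^ 2 ≤ T * 1 := by linarith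
      _ ≤ T * Real.sqrt (Real.log T) := mul_le_mul_of_nonneg_left hsL1 hT0.le

/-- The bookkeeping of the assembly: pure real arithmetic. [folklore] -/
private theorem final_bookkeeping {T x sL θ L J F Φ CZ CR : ℝ} (hT : 4 ≤ T) (hx : 1 ≤ x)
    (hxT : x ≤ T) (hsL0 : 0 < sL) (hsL2 : sL ^ 2 = Real.log T) (hθ1 : θ ≤ 1)
    (hL0 : 0 ≤ L) (hCZ : 0 ≤ CZ) (hCR : 0 ≤ CR)
    (hZ : |J - π / 2 * F| ≤ CZ * (x ^ (2 * θ - 1) * L ^ 3 + x * L ^ 2 / T))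
    (hΦ : Φ = 4 * x * J)
    (hR : |Φ - (T * x * Real.log x + T / x * Real.log T ^ 2)| ≤ CR * (T * sL ^ 3 / x + x * T * sL))
    (hθev : T ^ (θ - 1) * L ^ 3 ≤ sL) (hE4 : Real.sqrt T * L ^ 3 ≤ T * sL) (hE5 : L ^ 2 ≤ T * sL) :
    |F - (T / (2 * π * x ^ 2) * Real.log T ^ 2 + T / (2 * π) * Real.log x)| ≤
      (CR + 2 * CZ + 1) * (T / (2 * π * x ^ 2) * Real.log T ^ 2 / sL + T * sL) := by
  have hx0 : 0 < x := by linarith only [hx]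
  have hT0 : 0 < T := by linarith only [hT]
  have hπ3 : 3 < π := Real.pi_gt_three
  have hπ0 : 0 < π := Real.pi_pos
  have hxT0 : 0 ≤ x * T := (mul_pos hx0 hT0).le
  have hTsL : 0 ≤ T * sL := mul_nonneg hT0.le hsL0.le
  -- the factor `x^{2θ−1} L³ ≤ T sL`
  have hxpow : x ^ (2 * θ - 1) * L ^ 3 ≤ T * sL := by
    have hL3 : 0 ≤ L ^ 3 := pow_nonneg hL0 3
    rcases le_total x (Real.sqrt T) with hle | hge
    · -- `x ≤ √T`: `x^{2θ−1} ≤ x ≤ √T`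
      have h1 : x ^ (2 * θ - 1) ≤ x := by
        calc x ^ (2 * θ - 1) ≤ x ^ (1 : ℝ) :=
              Real.rpow_le_rpow_of_exponent_le hx (by linarith only [hθ1])
          _ = x := Real.rpow_one x
      calc x ^ (2 * θ - 1) * L ^ 3 ≤ Real.sqrt T * L ^ 3 :=
            mul_le_mul_of_nonneg_right (h1.trans hle) hL3
        _ ≤ T * sL := hE4
    · -- `√T ≤ x`: `x^{2θ−1} = x · x^{2(θ−1)} ≤ x T^{θ−1}`
      have hsT0 : 0 < Real.sqrt T := Real.sqrt_pos.2 hT0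
      have h1 : x ^ (2 * θ - 1) = x * x ^ (2 * (θ - 1)) := by
        rw [show 2 * θ - 1 = 1 + 2 * (θ - 1) by ring, Real.rpow_add hx0, Real.rpow_one]
      have h2 : x ^ (2 * (θ - 1)) ≤ Real.sqrt T ^ (2 * (θ - 1)) :=
        Real.rpow_le_rpow_of_nonpos hsT0 hge (by linarith only [hθ1])
      have h3 : Real.sqrt T ^ (2 * (θ - 1)) = T ^ (θ - 1) := by
        rw [Real.sqrt_eq_rpow, ← Real.rpow_mul hT0.le]
        congr 1; ring
      rw [h3] at h2
      have h4 : x ^ (2 * θ - 1) * L ^ 3 ≤ x * (T ^ (θ - 1) * L ^ 3) := by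
        rw [h1, mul_assoc]
        exact mul_le_mul_of_nonneg_left (mul_le_mul_of_nonneg_right h2 hL3) hx0.le
      calc x ^ (2 * θ - 1) * L ^ 3 ≤ x * (T ^ (θ - 1) * L ^ 3) := h4
        _ ≤ x * sL := mul_le_mul_of_nonneg_left hθev hx0.le
        _ ≤ T * sL := mul_le_mul_of_nonneg_right hxT hsL0.le
  have hxL : x * L ^ 2 / T ≤ T * sL := by
    have h1 : x * L ^ 2 / T ≤ L ^ 2 := by
      rw [div_le_iff₀ hT0]
      calc x * L ^ 2 ≤ T * L ^ 2 := mul_le_mul_of_nonneg_right hxT (sq_nonneg L)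
        _ = L ^ 2 * T := mul_comm _ _
    exact h1.trans hE5
  -- the zero side in the units of `Φ`
  have hZ2 : |J - π / 2 * F| ≤ 2 * CZ * (T * sL) := by
    refine hZ.trans ?_
    have := add_le_add hxpow hxL
    calc CZ * (x ^ (2 * θ - 1) * L ^ 3 + x * L ^ 2 / T) ≤ CZ * (T * sL + T * sL) :=
          mul_le_mul_of_nonneg_left this hCZ
      _ = 2 * CZ * (T * sL) := by ring
  have hkey : |2 * π * x * F - (T * x * Real.log x + T / x * Real.log T ^ 2)| ≤
      8 * CZ * (x * T * sL) + CR * (T * sL ^ 3 / x + x * T * sL) := by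
    have e : 2 * π * x * F - (T * x * Real.log x + T / x * Real.log T ^ 2) =
        (Φ - (T * x * Real.log x + T / x * Real.log T ^ 2)) - 4 * x * (J - π / 2 * F) := by
      rw [hΦ]; ring
    rw [e]
    refine (abs_sub _ _).trans ?_
    rw [abs_mul, abs_of_pos (by linarith only [hx0] : (0 : ℝ) < 4 * x)]
    have h1 := mul_le_mul_of_nonneg_left hZ2 (by linarith only [hx0] : (0 : ℝ) ≤ 4 * x)
    have e2 : 4 * x * (2 * CZ * (T * sL)) = 8 * CZ * (x * T * sL) := by ring
    linarith only [hR, h1, e2]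
  -- divide by `2πx`
  have h2πx : 0 < 2 * π * x := by positivity
  have e1 : F - (T / (2 * π * x ^ 2) * Real.log T ^ 2 + T / (2 * π) * Real.log x) =
      (2 * π * x * F - (T * x * Real.log x + T / x * Real.log T ^ 2)) / (2 * π * x) := by
    field_simp
    ring
  rw [e1, abs_div, abs_of_pos h2πx, div_le_iff₀ h2πx]
  refine hkey.trans ?_
  -- compare the two sides
  have hsL3 : sL ^ 3 = Real.log T ^ 2 / sL := by
    rw [← hsL2]; field_simp
  have eA : T / (2 * π * x ^ 2) * Real.log T ^ 2 / sL * (2 * π * x) = T * sL ^ 3 / x := by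
    rw [hsL3]; field_simp
  have hE1 : 0 ≤ T * sL ^ 3 / x := div_nonneg (mul_nonneg hT0.le (pow_nonneg hsL0.le 3)) hx0.le
  have hE2 : 0 ≤ x * T * sL := mul_nonneg hxT0 hsL0.le
  have eR : (CR + 2 * CZ + 1) * (T / (2 * π * x ^ 2) * Real.log T ^ 2 / sL + T * sL) * (2 * π * x) =
      (CR + 2 * CZ + 1) * (T * sL ^ 3 / x) + (CR + 2 * CZ + 1) * (2 * π) * (x * T * sL) := by
    rw [mul_add, add_mul, mul_assoc (CR + 2 * CZ + 1) (T / (2 * π * x ^ 2) * Real.log T ^ 2 / sL), eA]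
    ring
  rw [eR]
  have h1 : CR * (T * sL ^ 3 / x) ≤ (CR + 2 * CZ + 1) * (T * sL ^ 3 / x) :=
    mul_le_mul_of_nonneg_right (by linarith only [hCZ]) hE1
  have h2 : 8 * CZ * (x * T * sL) + CR * (x * T * sL) ≤ (CR + 2 * CZ + 1) * (2 * π) * (x * T * sL) := by
    have : 8 * CZ + CR ≤ (CR + 2 * CZ + 1) * (2 * π) := by nlinarith only [hπ3, hCZ, hCR]
    have := mul_le_mul_of_nonneg_right this hE2
    linarith only [this]
  linarith only [h1, h2]

/-- `‖z − m‖ = |Re z − m|` for real `z` (`Im z = 0`) and real `m`. [folklore] -/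
private theorem norm_sub_ofReal_eq {z : ℂ} (hz : z.im = 0) (m : ℝ) : ‖z - (m : ℂ)‖ = |z.re - m| := by
  have : z = (z.re : ℂ) := Complex.ext (by simp) (by simp [hz])
  rw [this, ← Complex.ofReal_sub, Complex.norm_real, Real.norm_eq_abs, Complex.ofReal_re]

/-- **Discharge of `baluyotEtAl2025_montgomeryTheorem` — the unconditional Montgomery theorem (MT) of
Baluyot–Goldston–Suriajaya–Turnage-Butterbaugh 2025, §2:** for `x ≥ 1`, `T ≥ 3`, `𝓕(x,T) ≥ 0` (real,
non-negative) and `𝓕(1/x,T) = 𝓕(x,T)` (`baluyotEtAl2025_montgomeryTheorem_qualitative`, Lemma 3), and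
there are `C, T₀` with `|𝓕(x,T) − (T/(2πx²) log²T + (T/2π) log x)| ≤ C (T/(2πx²) log²T/√log T + T√log T)`
for `T ≥ T₀`, `1 ≤ x ≤ T`. Proof: `2πx·Re 𝓕 = 4x∫_T^{2T}|S_u|² + O(x·(x^{2θ−1}log³T + x log²T/T))`
(`dyadic_zeroSide`, Lemmas 3–4) `= ∫_T^{2T}|2x^{1/2−it}S_u|² + … = Tx log x + (T/x)log²T +
O(T log^{3/2}T/x + xT√log T)` (`rside_window`, Lemma 1 and [GM87]), with `θ = θ(T)` from the
Vinogradov–Korobov region (`exists_vkTheta`): `x^{2θ−1}log³T ≤ T√log T` for `x ≤ √T` trivially and for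
`√T ≤ x ≤ T` by `T^{θ−1}log³T ≤ √log T`. [cite: BaluyotEtAl2025, §2 (MT) (Mon-1) and §3] -/
theorem _root_.Literature.NumberTheory.LFunctions.baluyotEtAl2025_montgomeryTheorem_holds :
    baluyotEtAl2025_montgomeryTheorem := by
  refine ⟨baluyotEtAl2025_montgomeryTheorem_qualitative, ?_⟩
  obtain ⟨CZ, hCZpos, hZ⟩ := dyadic_zeroSide
  obtain ⟨CR, hCR0, hR⟩ := rside_window
  obtain ⟨θ, hθ, hθev⟩ := exists_vkTheta
  obtain ⟨T₀, hT₀⟩ := Filter.eventually_atTop.1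
    ((hθev.and eventually_log_window_le).and (eventually_ge_atTop (5 : ℝ)))
  refine ⟨CR + 2 * CZ + 1, T₀, fun T hT x hx hxT ↦ ?_⟩
  obtain ⟨⟨hθT, hE4, hE5⟩, hT5⟩ := hT₀ T hT
  have hT4 : (4 : ℝ) ≤ T := by linarith
  have hT0 : 0 < T := by linarith
  have hx0 : 0 < x := by linarith
  obtain ⟨hθ1, -, hθzeros⟩ := hθ T hT5
  have hlog : 0 < Real.log T := Real.log_pos (by linarith)
  set sL : ℝ := Real.sqrt (Real.log T) with hsL
  have hsL0 : 0 < sL := Real.sqrt_pos.2 hlog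
  have hsL2 : sL ^ 2 = Real.log T := Real.sq_sqrt hlog.le
  -- the three analytic inputs
  have hZ' := hZ T hT4 x hx (θ T) hθ1 hθzeros
  have hR' := hR T hT4 x hx hxT
  have hΦ : (∫ t in T..(2 * T), ‖2 * (x : ℂ) ^ ((1 / 2 : ℂ) - t * I) * zeroKernelSeries x t‖ ^ 2) =
      4 * x * ∫ t in T..(2 * T), ‖zeroKernelSeries x t‖ ^ 2 := by
    rw [← intervalIntegral.integral_const_mul]
    refine intervalIntegral.integral_congr fun t _ ↦ ?_
    simp only [norm_sq_two_mul_cpow_mul hx0]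
  -- `𝓕` is real
  have hreal := (baluyotEtAl2025_montgomeryTheorem_qualitative x T hx (by linarith)).1
  rw [norm_sub_ofReal_eq hreal]
  have key := final_bookkeeping hT4 hx hxT hsL0 hsL2 hθ1 (Real.log_nonneg (by linarith)) hCZpos.le hCR0
    hZ' hΦ hR' hθT hE4 hE5
  have e : T / (2 * π * x ^ 2) * Real.log T ^ 2 / sL = T / (2 * π * x ^ 2) * Real.log T ^ 2 / Real.sqrt (Real.log T) := by
    rw [hsL]
  rw [e] at key
  exact key

end BGSTB2024

end Literature.NumberTheory.LFunctions

end
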